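import Literature.NumberTheory.Sieve.FejerKernelCounting
import Literature.NumberTheory.Sieve.PolynomialCongruencesMeanValues
import HarnessLib

/-!
# Type-I information for the congruence counts of a polynomial from level Weyl-sum bounds

Topic `Literature/NumberTheory/Sieve` (polynomial congruences; companion of
`LiouvillePolynomialValuesTypeIProofs.lean`).  For `P ∈ ℤ[X]` irreducible over `ℚ` and a
progression `t ≡ b₀ (mod q)`, the "type-I" sums

  `T = ∑_{N₁ < n ≤ N₂, ℓ ∣ n, (n, Q) = 1} ( #{y < t ≤ 2y : t ≡ b₀ (q), n ∣ P(t)} − (y/q) ρ_P(n)/n )`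

over level-`ℓ` moduli `n` up to `y^{1+θ}` (beyond the length `y` of the `t`-range) are what the
cofactor sieve of `LiouvillePolynomialValuesTypeIProofs.lean` (Teräväinen 2024, Prop. 2.11,
property S for quadratics) consumes as its only unproved input.  This file PROVES
(`TypeIFromWeyl.typeI_of_weylLevelBound`) that `|T| ≤ K y^{1−ε}` for all `1 ≤ ℓ ≤ y^ε`,
`N₂ ≤ y^{1+ε}`, `y ≥ y₀(q, b₀, Q)`, with `ε = ε(δ₀, C) > 0` (any `ε ≤ δ₀/(20 + 6C)`), for every
`Q ≠ 0` containing the primes of `q`, of `cont P` and of `2 · lc P · disc P`, from a **level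
Weyl-sum bound on the moduli prime to `Q`** for the polynomials `G = P(qX + b₁)`:

  `|∑_{n ≤ x, L ∣ n, (n,Q)=1} ∑_{ν mod n, G(ν) ≡ 0 (n)} e(hν/n)| ≤ K (1 + |h|)^C L^C x^{1−δ₀}`
  for all `x`, `L ≥ 1`, `h ≠ 0`

(the inner sum is the tree's `polyRootWeylSum G n h`) — a power-saving, level-`L` form of
Hooley's equidistribution of the roots of a quadratic congruence (Hooley 1963/1967; for
`n² + 1` and level `λ` this is Hooley's estimate (75)–(80) of Ch. 2 of *Applications of sieve
methods*, via Kloosterman sums).  The argument is Hooley's (Ch. 2 §3): substitute `t = qs + b₁`,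
so that the count is the number of `s ∈ ((y − b₁)/q, (2y − b₁)/q]` in the `ρ_G(n)` root classes
modulo `n` (`card_progression_eq`; `ρ_G = ρ_P` on `(n, q) = 1`, `card_rootSet_comp_eq`); below
`N₀ = y^{1−2ε}` bound trivially; above, cut into blocks of length `y^{1−7ε}` on which `⌊Y/n⌋` is
constant (`fiber_eq`), count the fractional parts `{(S − σ)/n}` in `[0, {Y/n})` by the tree's
Fejér-kernel counting inequalities (`FejerCounting.card_filter_fract_lt_le`,
`le_card_filter_fract_lt`; `abs_sum_disc_le`), remove the phase `e(hS/n)` by Abel summation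
(`norm_blockWeyl_le`); `norm_sum_level_coprime_le` records the Möbius passage from Weyl bounds
over ALL moduli of a level to the moduli prime to `Q` (levels `lcm(ℓ, e)`, `e ∣ Q`), should only
that form be available.  `abs_typeI_le` is the abstract inequality (for any
family of root sets `R(n)`), `typeI_of_weylLevelBound` the instantiation with the parameters
above; `∑_{n ≤ k} ρ(n) ≪ k` is the tree's `exists_sum_rootCount_le` (for the primitive part).

Everything here is PROVED; no named fact is introduced (the level Weyl-sum bound is a HYPOTHESIS
of the final theorem, to be supplied by the Hooley/DFI root-equidistribution files of the
tree); the defs (`countA`, `disc`, `weylC`, `rootSet`) are data.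

## References

* C. Hooley, *Applications of sieve methods to the theory of numbers*, Cambridge Tracts 70
  (1976), Ch. 2 §§3–6 (the `ψ`-expansion of `Υ(u; λ)`, (51)–(60), and the level-`λ` Weyl sums
  `Ρ_λ(h, u)`, (66)–(80)). [cite: Hooley1976, Ch. 2 §§3–6]
* C. Hooley, *On the greatest prime factor of a quadratic polynomial*, Acta Math. 117 (1967)
  281–299, §§3–6. [cite: Hooley1967, §§3–6]
* J. Teräväinen, Amer. J. Math. 146 (2024), Proposition 2.11 (the application).
  [cite: Teravainen2024, Proposition 2.11]
* H. L. Montgomery, *Ten lectures on the interface between analytic number theory and harmonic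
  analysis*, CBMS 84 (1994), Ch. 1 (Erdős–Turán / Fejér kernel, via the tree's
  `FejerKernelCounting.lean`).
-/

noncomputable section

open Finset Real
open scoped FourierTransform

namespace Literature.NumberTheory.Sieve

namespace TypeIFromWeyl

open Literature.NumberTheory.Sieve.FejerCounting (card_filter_fract_lt_le le_card_filter_fract_lt)
open Literature.NumberTheory.Sieve.Vinogradov (norm_fourierChar norm_fourierChar_sub_one)

/-! ### D-a. Counting in a progression class: floors and fractional parts -/

/-- `⌊u⌋ − ⌊u − λ⌋ = ⌊λ⌋ + [fract u < fract λ]` for `λ ≥ 0` real: the number of integers in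
`(u − λ, u]`. [folklore] -/
theorem floor_sub_floor_sub (u lam : ℝ) :
    (⌊u⌋ - ⌊u - lam⌋ : ℤ) = ⌊lam⌋ + (if Int.fract u < Int.fract lam then 1 else 0) := by
  have hlam : lam = ⌊lam⌋ + Int.fract lam := (Int.floor_add_fract lam).symm
  have hu : u = ⌊u⌋ + Int.fract u := (Int.floor_add_fract u).symm
  have h1 : u - lam = (u - Int.fract lam) - (⌊lam⌋ : ℤ) := by
    have := Int.floor_add_fract lam; linarith
  rw [h1, Int.floor_sub_intCast]
  have hf0 := Int.fract_nonneg u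
  have hf1 := Int.fract_lt_one u
  have hg0 := Int.fract_nonneg lam
  have hg1 := Int.fract_lt_one lam
  split_ifs with hlt
  · have : ⌊u - Int.fract lam⌋ = ⌊u⌋ - 1 := by
      rw [Int.floor_eq_iff]
      push_cast
      constructor <;> linarith
    rw [this]; ring
  · push Not at hlt
    have : ⌊u - Int.fract lam⌋ = ⌊u⌋ := by
      rw [Int.floor_eq_iff]
      constructor <;> linarith
    rw [this]; ring

/-- The number of `s ∈ ℤ`, `S − Y < s ≤ S`, `s ≡ σ (mod n)` is `⌊(S−σ)/n⌋ − ⌊(S−Y−σ)/n⌋ =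
⌊Y/n⌋ + [fract((S−σ)/n) < fract(Y/n)]`. [folklore] -/
theorem floor_div_sub_floor_div (S Y σ : ℝ) {n : ℝ} (hn : 0 < n) :
    (⌊(S - σ) / n⌋ - ⌊(S - Y - σ) / n⌋ : ℤ) =
      ⌊Y / n⌋ + (if Int.fract ((S - σ) / n) < Int.fract (Y / n) then 1 else 0) := by
  have : (S - Y - σ) / n = (S - σ) / n - Y / n := by field_simp; ring
  rw [this]
  exact floor_sub_floor_sub _ _

variable (R : ℕ → Finset ℕ)

/-- The count `A(n) = ∑_{σ ∈ R(n)} #{s ∈ ℤ : S − Y < s ≤ S, s ≡ σ (mod n)}`. [folklore] -/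
def countA (S Y : ℝ) (n : ℕ) : ℤ := ∑ σ ∈ R n, (⌊(S - σ) / n⌋ - ⌊(S - Y - σ) / n⌋)

/-- The discrepancy `A(n) − (Y/n) ρ(n)`. [folklore] -/
def disc (S Y : ℝ) (n : ℕ) : ℝ := (countA R S Y n : ℝ) - Y / n * (R n).card

/-- The conjugate Weyl sum `W̄_d(n) = ∑_{σ ∈ R(n)} e(−dσ/n)`. [folklore] -/
def weylC (n : ℕ) (d : ℤ) : ℂ := ∑ σ ∈ R n, (𝐞 (-((d : ℝ) * (σ : ℝ) / n)) : ℂ)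

/-- `|W̄_d(n)| ≤ ρ(n)`. [folklore] -/
theorem norm_weylC_le (n : ℕ) (d : ℤ) : ‖weylC R n d‖ ≤ (R n).card := by
  unfold weylC
  refine (norm_sum_le _ _).trans ?_
  have : ∀ σ ∈ R n, ‖(𝐞 (-((d : ℝ) * (σ : ℝ) / n)) : ℂ)‖ ≤ 1 := fun σ _ => (norm_fourierChar _).le
  refine (Finset.sum_le_sum this).trans ?_
  simp

/-- The discrepancy on a block where `⌊Y/n⌋ = m`: `disc(n) = #{σ : fract((S−σ)/n) < f(n)} −
f(n) ρ(n)`, `f(n) = fract(Y/n)`. [folklore] -/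
theorem disc_eq (S Y : ℝ) {n : ℕ} (hn : 0 < n) :
    disc R S Y n = (((R n).filter (fun σ : ℕ => Int.fract ((S - (σ : ℝ)) / (n : ℝ)) < Int.fract (Y / n))).card : ℝ) -
      Int.fract (Y / n) * (R n).card := by
  have hn' : (0 : ℝ) < n := by exact_mod_cast hn
  unfold disc countA
  have hsum : ∑ σ ∈ R n, (⌊(S - (σ : ℝ)) / (n : ℝ)⌋ - ⌊(S - Y - (σ : ℝ)) / (n : ℝ)⌋) =
      ∑ σ ∈ R n, (⌊Y / (n : ℝ)⌋ +
        (if Int.fract ((S - (σ : ℝ)) / (n : ℝ)) < Int.fract (Y / n) then 1 else 0)) :=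
    Finset.sum_congr rfl fun σ _ => floor_div_sub_floor_div S Y (σ : ℝ) hn'
  rw [hsum, Finset.sum_add_distrib, Finset.sum_const, Finset.sum_boole, nsmul_eq_mul]
  push_cast
  have hY : Y / n = ⌊Y / n⌋ + Int.fract (Y / n) := (Int.floor_add_fract _).symm
  linear_combination (-((R n).card : ℝ)) * hY

/-- `|disc(n)| ≤ ρ(n)` (trivially). [folklore] -/
theorem abs_disc_le (S Y : ℝ) {n : ℕ} (hn : 0 < n) : |disc R S Y n| ≤ (R n).card := by
  rw [disc_eq R S Y hn]
  have h1 : (((R n).filter (fun σ : ℕ => Int.fract ((S - (σ : ℝ)) / (n : ℝ)) < Int.fract (Y / n))).card : ℝ) ≤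
      (R n).card := by exact_mod_cast Finset.card_filter_le _ _
  have h2 : (0 : ℝ) ≤ ((R n).filter (fun σ : ℕ => Int.fract ((S - (σ : ℝ)) / (n : ℝ)) < Int.fract (Y / n))).card :=
    Nat.cast_nonneg _
  have h3 := Int.fract_nonneg (Y / n)
  have h4 := (Int.fract_lt_one (Y / n)).le
  have h5 : (0 : ℝ) ≤ (R n).card := Nat.cast_nonneg _
  rw [abs_le]
  constructor <;> nlinarith

/-! ### D-b. One block: the Fejér-kernel counting inequalities -/

/-- **The discrepancy over a block of moduli**: let `𝒩` be a finite set of moduli `n` with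
`A + 1 ≤ n ≤ B` (`A + 1 > 0`) on which `⌊Y/n⌋ = m` is constant (`Y ≥ 0`).  Then for
`0 < δ ≤ 1/4`, `(H+1)δ ≥ 1`,
`|∑_{n ∈ 𝒩} disc(n)| ≤ (Y/(A+1) − Y/B) N + 2δN + 2N/((H+1)δ) + ∑_{0<|d|≤H} |∑_{n∈𝒩} e(dS/n) W̄_d(n)|/|d|`,
`N = ∑_{n∈𝒩} ρ(n)` (the tree's `FejerCounting.card_filter_fract_lt_le` / `le_card_filter_fract_lt`
for the points `(S − σ)/n` against `[0, f)`, `f` between `fract(Y/B)`-ish and `fract(Y/(A+1))`).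
[folklore] -/
theorem abs_sum_disc_le (S : ℝ) {Y : ℝ} (hY : 0 ≤ Y) {A B : ℝ} (hA : 0 < A + 1) (hAB : A + 1 ≤ B)
    (m : ℤ) (𝒩 : Finset ℕ) (h𝒩 : ∀ n ∈ 𝒩, A + 1 ≤ (n : ℝ) ∧ (n : ℝ) ≤ B)
    (hm : ∀ n ∈ 𝒩, ⌊Y / n⌋ = m) (H : ℕ) {δ : ℝ} (hδ : 0 < δ) (hδ4 : δ ≤ 1 / 4)
    (hH : 1 ≤ (H + 1) * δ) :
    |∑ n ∈ 𝒩, disc R S Y n| ≤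
      (Y / (A + 1) - Y / B) * (∑ n ∈ 𝒩, ((R n).card : ℝ)) +
        2 * δ * (∑ n ∈ 𝒩, ((R n).card : ℝ)) +
        2 * (∑ n ∈ 𝒩, ((R n).card : ℝ)) / ((H + 1) * δ) +
        ∑ d ∈ (Icc (-(H : ℤ)) H).erase 0,
          ‖∑ n ∈ 𝒩, (𝐞 ((d : ℝ) * S / n) : ℂ) * weylC R n d‖ / |(d : ℝ)| := by
  classical
  -- degenerate case: `𝒩 = ∅`
  rcases 𝒩.eq_empty_or_nonempty with h0 | hne
  · subst h0
    simp only [Finset.sum_empty, norm_zero, zero_div, Finset.sum_const_zero, abs_zero, mul_zero,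
      add_zero, le_refl]
  obtain ⟨n₀, hn₀⟩ := hne
  -- the points `(S − σ)/n`, indexed by the pairs `⟨n, σ⟩`
  obtain ⟨N, hN⟩ : ∃ N : ℝ, ∑ n ∈ 𝒩, ((R n).card : ℝ) = N := ⟨_, rfl⟩
  rw [hN]
  have hcard : ((𝒩.sigma R).card : ℝ) = N := by
    rw [← hN, Finset.card_sigma, Nat.cast_sum]
  have hN0 : 0 ≤ N := hN ▸ Finset.sum_nonneg fun _ _ => Nat.cast_nonneg _
  -- the Weyl sums of the points
  have hweyl : ∀ d : ℤ, ∑ i ∈ 𝒩.sigma R, (𝐞 ((d : ℝ) * ((S - (i.2 : ℝ)) / (i.1 : ℝ))) : ℂ) =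
      ∑ n ∈ 𝒩, (𝐞 ((d : ℝ) * S / n) : ℂ) * weylC R n d := by
    intro d
    rw [Finset.sum_sigma]
    refine Finset.sum_congr rfl fun n _ => ?_
    rw [weylC, Finset.mul_sum]
    refine Finset.sum_congr rfl fun σ _ => ?_
    rw [← Circle.coe_mul, ← AddChar.map_add_eq_mul]
    congr 2
    ring
  -- `f(n) = Y/n − m` and its range
  have hpos : ∀ n ∈ 𝒩, (0 : ℝ) < n := fun n hn => lt_of_lt_of_le hA (h𝒩 n hn).1
  have hposN : ∀ n ∈ 𝒩, 0 < n := fun n hn => by exact_mod_cast hpos n hn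
  have hf : ∀ n ∈ 𝒩, Int.fract (Y / n) = Y / n - m := fun n hn => by
    rw [Int.fract, hm n hn]
  set ftop : ℝ := min 1 (Y / (A + 1) - m) with hftop
  set fbot : ℝ := max 0 (Y / B - m) with hfbot
  have hB0 : 0 < B := lt_of_lt_of_le hA hAB
  have hfle : ∀ n ∈ 𝒩, Int.fract (Y / n) ≤ ftop := fun n hn => by
    refine le_min (Int.fract_lt_one _).le ?_
    rw [hf n hn]
    have : Y / n ≤ Y / (A + 1) := div_le_div_of_nonneg_left hY hA (h𝒩 n hn).1
    linarith
  have hlef : ∀ n ∈ 𝒩, fbot ≤ Int.fract (Y / n) := fun n hn => by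
    refine max_le (Int.fract_nonneg _) ?_
    rw [hf n hn]
    have : Y / B ≤ Y / n := div_le_div_of_nonneg_left hY (hpos n hn) (h𝒩 n hn).2
    linarith
  have hftop1 : ftop ≤ 1 := min_le_left _ _
  have hfbot0 : 0 ≤ fbot := le_max_left _ _
  have hgap : ftop - fbot ≤ Y / (A + 1) - Y / B := by
    have h1 : ftop ≤ Y / (A + 1) - m := min_le_right _ _
    have h2 : Y / B - m ≤ fbot := le_max_right _ _
    linarith
  have hbt : fbot ≤ ftop := (hlef n₀ hn₀).trans (hfle n₀ hn₀)
  have hftop0 : 0 ≤ ftop := hfbot0.trans hbt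
  have hfbot1 : fbot ≤ 1 := hbt.trans hftop1
  -- counts as sums of indicators
  have hcount : ∀ f : ℝ, (((𝒩.sigma R).filter
      (fun i : (Σ _ : ℕ, ℕ) => Int.fract ((S - (i.2 : ℝ)) / (i.1 : ℝ)) < f)).card : ℝ) =
      ∑ n ∈ 𝒩, (((R n).filter (fun σ : ℕ => Int.fract ((S - (σ : ℝ)) / (n : ℝ)) < f)).card : ℝ) := by
    intro f
    rw [Finset.natCast_card_filter, Finset.sum_sigma]
    refine Finset.sum_congr rfl fun n _ => ?_
    rw [Finset.natCast_card_filter]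
  -- the discrepancy rewritten
  have hdisc : ∀ n ∈ 𝒩, disc R S Y n =
      (((R n).filter (fun σ : ℕ => Int.fract ((S - (σ : ℝ)) / (n : ℝ)) < Int.fract (Y / n))).card : ℝ) -
        Int.fract (Y / n) * (R n).card := fun n hn => disc_eq R S Y (hposN n hn)
  -- monotonicity of the count in `f`
  have hmono : ∀ n ∈ 𝒩, ∀ f g : ℝ, f ≤ g →
      (((R n).filter (fun σ : ℕ => Int.fract ((S - (σ : ℝ)) / (n : ℝ)) < f)).card : ℝ) ≤
        (((R n).filter (fun σ : ℕ => Int.fract ((S - (σ : ℝ)) / (n : ℝ)) < g)).card : ℝ) := by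
    intro n _ f g hfg
    exact_mod_cast Finset.card_le_card (Finset.monotone_filter_right _ fun σ _ h => lt_of_lt_of_le h hfg)
  -- the two Fejér inequalities
  have hU := card_filter_fract_lt_le (H := H) (𝒩.sigma R)
    (fun i : (Σ _ : ℕ, ℕ) => (S - (i.2 : ℝ)) / (i.1 : ℝ)) (α := 0) (β := ftop)
    (by linarith) (by linarith) hδ hδ4 hH
  have hL := le_card_filter_fract_lt (H := H) (𝒩.sigma R)
    (fun i : (Σ _ : ℕ, ℕ) => (S - (i.2 : ℝ)) / (i.1 : ℝ)) (α := 0) (β := fbot)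
    (by linarith) hδ (by linarith)
  simp only [sub_zero] at hU hL
  rw [hcount, hcard] at hU hL
  simp only [hweyl] at hU hL
  set E : ℝ := ∑ d ∈ (Icc (-(H : ℤ)) H).erase 0,
    ‖∑ n ∈ 𝒩, (𝐞 ((d : ℝ) * S / n) : ℂ) * weylC R n d‖ / |(d : ℝ)| with hE
  -- upper bound
  have hup : ∑ n ∈ 𝒩, disc R S Y n ≤ (Y / (A + 1) - Y / B) * N + 2 * δ * N +
      2 * N / ((H + 1) * δ) + E := by
    have h1 : ∑ n ∈ 𝒩, disc R S Y n ≤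
        ∑ n ∈ 𝒩, ((((R n).filter (fun σ : ℕ => Int.fract ((S - (σ : ℝ)) / (n : ℝ)) < ftop)).card : ℝ) -
          Int.fract (Y / n) * (R n).card) := by
      refine Finset.sum_le_sum fun n hn => ?_
      rw [hdisc n hn]
      linarith [hmono n hn _ _ (hfle n hn)]
    have h2 : ∑ n ∈ 𝒩, ((((R n).filter (fun σ : ℕ => Int.fract ((S - (σ : ℝ)) / (n : ℝ)) < ftop)).card : ℝ) -
          Int.fract (Y / n) * (R n).card) =
        (∑ n ∈ 𝒩, (((R n).filter (fun σ : ℕ => Int.fract ((S - (σ : ℝ)) / (n : ℝ)) < ftop)).card : ℝ) -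
          ftop * N) + ∑ n ∈ 𝒩, (ftop - Int.fract (Y / n)) * (R n).card := by
      rw [← hN, Finset.mul_sum, ← Finset.sum_sub_distrib, ← Finset.sum_add_distrib]
      refine Finset.sum_congr rfl fun n _ => ?_
      ring
    have h3 : ∑ n ∈ 𝒩, (ftop - Int.fract (Y / n)) * (R n).card ≤ (Y / (A + 1) - Y / B) * N := by
      rw [← hN, Finset.mul_sum]
      refine Finset.sum_le_sum fun n hn => ?_
      have : ftop - Int.fract (Y / n) ≤ Y / (A + 1) - Y / B := by linarith [hlef n hn]
      exact mul_le_mul_of_nonneg_right this (Nat.cast_nonneg _)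
    linarith
  -- lower bound
  have hlow : -((Y / (A + 1) - Y / B) * N + 2 * δ * N + 2 * N / ((H + 1) * δ) + E) ≤
      ∑ n ∈ 𝒩, disc R S Y n := by
    have h1 : ∑ n ∈ 𝒩, ((((R n).filter (fun σ : ℕ => Int.fract ((S - (σ : ℝ)) / (n : ℝ)) < fbot)).card : ℝ) -
          Int.fract (Y / n) * (R n).card) ≤ ∑ n ∈ 𝒩, disc R S Y n := by
      refine Finset.sum_le_sum fun n hn => ?_
      rw [hdisc n hn]
      linarith [hmono n hn _ _ (hlef n hn)]
    have h2 : ∑ n ∈ 𝒩, ((((R n).filter (fun σ : ℕ => Int.fract ((S - (σ : ℝ)) / (n : ℝ)) < fbot)).card : ℝ) -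
          Int.fract (Y / n) * (R n).card) =
        (∑ n ∈ 𝒩, (((R n).filter (fun σ : ℕ => Int.fract ((S - (σ : ℝ)) / (n : ℝ)) < fbot)).card : ℝ) -
          fbot * N) - ∑ n ∈ 𝒩, (Int.fract (Y / n) - fbot) * (R n).card := by
      rw [← hN, Finset.mul_sum, ← Finset.sum_sub_distrib, ← Finset.sum_sub_distrib]
      refine Finset.sum_congr rfl fun n _ => ?_
      ring
    have h3 : ∑ n ∈ 𝒩, (Int.fract (Y / n) - fbot) * (R n).card ≤ (Y / (A + 1) - Y / B) * N := by
      rw [← hN, Finset.mul_sum]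
      refine Finset.sum_le_sum fun n hn => ?_
      have : Int.fract (Y / n) - fbot ≤ Y / (A + 1) - Y / B := by linarith [hfle n hn]
      exact mul_le_mul_of_nonneg_right this (Nat.cast_nonneg _)
    have h4 : N / ((H + 1) * δ) ≤ 2 * N / ((H + 1) * δ) := by
      rw [div_le_div_iff_of_pos_right (by positivity)]; linarith
    linarith
  rw [abs_le]
  exact ⟨by linarith, by linarith⟩


/-! ### D-c. Abel summation against the slowly varying phase `e(dS/n)` -/

/-- **Abel summation (identity)**: `∑_{A<n≤B} c_n w_n = c_B Σ_B − ∑_{A+1≤n<B} (c_{n+1} − c_n) Σ_n`,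
`Σ_k = ∑_{A<n≤k} w_n`. [folklore] -/
theorem sum_Ioc_mul_eq_abel (A : ℕ) (c w : ℕ → ℂ) :
    ∀ B : ℕ, A ≤ B → ∑ n ∈ Ioc A B, c n * w n =
      c B * (∑ n ∈ Ioc A B, w n) -
        ∑ n ∈ Ico (A + 1) B, (c (n + 1) - c n) * ∑ k ∈ Ioc A n, w k := by
  intro B hB
  induction B, hB using Nat.le_induction with
  | base => simp
  | succ B hB ih =>
      rw [Finset.sum_Ioc_succ_top hB, Finset.sum_Ioc_succ_top hB, ih]
      rcases hB.lt_or_eq with hlt | heq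
      · rw [Finset.sum_Ico_succ_top (by omega : A + 1 ≤ B)]
        ring
      · subst heq
        simp

/-- **Abel summation (bound)**: if the partial sums `Σ_k` (`A ≤ k ≤ B`) are bounded by `Φ`,
`|c_n| ≤ 1` and `∑_{A+1≤n<B} |c_{n+1} − c_n| ≤ V`, then `|∑_{A<n≤B} c_n w_n| ≤ (1 + V) Φ`.
[folklore] -/
theorem norm_sum_Ioc_mul_le {A B : ℕ} (c w : ℕ → ℂ) {Φ V : ℝ} (hΦ0 : 0 ≤ Φ)
    (hΦ : ∀ k : ℕ, A ≤ k → k ≤ B → ‖∑ n ∈ Ioc A k, w n‖ ≤ Φ) (hc : ∀ n, ‖c n‖ ≤ 1)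
    (hV : ∑ n ∈ Ico (A + 1) B, ‖c (n + 1) - c n‖ ≤ V) :
    ‖∑ n ∈ Ioc A B, c n * w n‖ ≤ (1 + V) * Φ := by
  rcases lt_or_ge B A with hBA | hAB
  · rw [Finset.Ioc_eq_empty (by omega), Finset.sum_empty, norm_zero]
    have hV0 : 0 ≤ V := le_trans (Finset.sum_nonneg fun _ _ => norm_nonneg _) hV
    positivity
  rw [sum_Ioc_mul_eq_abel A c w B hAB]
  refine (norm_sub_le _ _).trans ?_
  have h1 : ‖c B * ∑ n ∈ Ioc A B, w n‖ ≤ Φ := by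
    rw [norm_mul]
    calc ‖c B‖ * ‖∑ n ∈ Ioc A B, w n‖ ≤ 1 * Φ :=
          mul_le_mul (hc B) (hΦ B hAB le_rfl) (norm_nonneg _) zero_le_one
      _ = Φ := one_mul Φ
  have h2 : ‖∑ n ∈ Ico (A + 1) B, (c (n + 1) - c n) * ∑ k ∈ Ioc A n, w k‖ ≤ V * Φ := by
    refine (norm_sum_le _ _).trans ?_
    calc ∑ n ∈ Ico (A + 1) B, ‖(c (n + 1) - c n) * ∑ k ∈ Ioc A n, w k‖
        ≤ ∑ n ∈ Ico (A + 1) B, ‖c (n + 1) - c n‖ * Φ := by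
          refine Finset.sum_le_sum fun n hn => ?_
          rw [Finset.mem_Ico] at hn
          rw [norm_mul]
          exact mul_le_mul_of_nonneg_left (hΦ n (by omega) (by omega)) (norm_nonneg _)
      _ = (∑ n ∈ Ico (A + 1) B, ‖c (n + 1) - c n‖) * Φ := (Finset.sum_mul _ _ _).symm
      _ ≤ V * Φ := mul_le_mul_of_nonneg_right hV hΦ0
  linarith

/-- `|e(x) − e(y)| ≤ 2π|x − y|`. [folklore] -/
theorem norm_fourierChar_sub_le (x y : ℝ) : ‖(𝐞 x : ℂ) - 𝐞 y‖ ≤ 2 * Real.pi * |x - y| := by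
  have h1 : (𝐞 x : ℂ) - 𝐞 y = 𝐞 y * ((𝐞 (x - y) : ℂ) - 1) := by
    rw [mul_sub, mul_one, ← Circle.coe_mul, ← AddChar.map_add_eq_mul, add_sub_cancel]
  rw [h1, norm_mul, norm_fourierChar, one_mul, norm_fourierChar_sub_one]
  have := Real.abs_sin_le_abs (x := Real.pi * (x - y))
  rw [abs_mul, abs_of_pos Real.pi_pos] at this
  linarith

/-- Telescoping: `∑_{A+1≤n<B} (1/n − 1/(n+1)) = 1/(A+1) − 1/B` (`A + 1 ≤ B`). [folklore] -/
theorem sum_Ico_inv_sub_inv (A : ℕ) : ∀ B : ℕ, A + 1 ≤ B →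
    ∑ n ∈ Ico (A + 1) B, (1 / (n : ℝ) - 1 / ((n : ℝ) + 1)) = 1 / ((A : ℝ) + 1) - 1 / B := by
  intro B hB
  induction B, hB using Nat.le_induction with
  | base => simp
  | succ B hB ih =>
      rw [Finset.sum_Ico_succ_top hB, ih]
      push_cast
      ring

/-- **The variation of `e(dS/n)`** over `A < n ≤ B`:
`∑_{A+1≤n<B} |e(dS/(n+1)) − e(dS/n)| ≤ 2π|d||S|(1/(A+1) − 1/B)` (for `A + 1 ≤ B`). [folklore] -/
theorem sum_norm_phase_sub_le (d : ℤ) (S : ℝ) {A B : ℕ} (hAB : A + 1 ≤ B) :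
    ∑ n ∈ Ico (A + 1) B, ‖(𝐞 ((d : ℝ) * S / ((n + 1 : ℕ) : ℝ)) : ℂ) - 𝐞 ((d : ℝ) * S / n)‖ ≤
      2 * Real.pi * |(d : ℝ)| * |S| * (1 / ((A : ℝ) + 1) - 1 / B) := by
  have hterm : ∀ n ∈ Ico (A + 1) B,
      ‖(𝐞 ((d : ℝ) * S / ((n + 1 : ℕ) : ℝ)) : ℂ) - 𝐞 ((d : ℝ) * S / n)‖ ≤
        2 * Real.pi * |(d : ℝ)| * |S| * (1 / (n : ℝ) - 1 / ((n : ℝ) + 1)) := by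
    intro n hn
    rw [Finset.mem_Ico] at hn
    have hn0 : (0 : ℝ) < n := by exact_mod_cast (show 0 < n by omega)
    refine (norm_fourierChar_sub_le _ _).trans ?_
    have heq : (d : ℝ) * S / ((n + 1 : ℕ) : ℝ) - (d : ℝ) * S / n =
        -((d : ℝ) * S * (1 / (n : ℝ) - 1 / ((n : ℝ) + 1))) := by
      push_cast
      field_simp
      ring
    rw [heq, abs_neg, abs_mul, abs_mul]
    have hpos : 0 ≤ 1 / (n : ℝ) - 1 / ((n : ℝ) + 1) := by
      rw [sub_nonneg]; exact one_div_le_one_div_of_le hn0 (by linarith)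
    rw [abs_of_nonneg hpos]
    nlinarith [Real.pi_pos, abs_nonneg (d : ℝ), abs_nonneg S]
  refine (Finset.sum_le_sum hterm).trans ?_
  rw [← Finset.mul_sum, sum_Ico_inv_sub_inv A B hAB]

/-- **The block Weyl sum against the phase**: if for `A ≤ k ≤ B` the partial sums
`∑_{A<n≤k, cond n} W̄_d(n)` are bounded by `Φ ≥ 0`, then
`|∑_{A<n≤B, cond n} e(dS/n) W̄_d(n)| ≤ (1 + 2π|d||S|(1/(A+1) − 1/B)) Φ`. [folklore] -/
theorem norm_blockWeyl_le (cond : ℕ → Prop) [DecidablePred cond] (d : ℤ) (S : ℝ) {A B : ℕ}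
    (hAB : A + 1 ≤ B) {Φ : ℝ} (hΦ0 : 0 ≤ Φ)
    (hΦ : ∀ k : ℕ, A ≤ k → k ≤ B → ‖∑ n ∈ (Ioc A k).filter cond, weylC R n d‖ ≤ Φ) :
    ‖∑ n ∈ (Ioc A B).filter cond, (𝐞 ((d : ℝ) * S / n) : ℂ) * weylC R n d‖ ≤
      (1 + 2 * Real.pi * |(d : ℝ)| * |S| * (1 / ((A : ℝ) + 1) - 1 / B)) * Φ := by
  set w : ℕ → ℂ := fun n => if cond n then weylC R n d else 0 with hw
  have hsum : ∑ n ∈ (Ioc A B).filter cond, (𝐞 ((d : ℝ) * S / n) : ℂ) * weylC R n d =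
      ∑ n ∈ Ioc A B, (𝐞 ((d : ℝ) * S / n) : ℂ) * w n := by
    rw [Finset.sum_filter]
    refine Finset.sum_congr rfl fun n _ => ?_
    rw [hw]; dsimp only
    split_ifs <;> simp
  rw [hsum]
  refine norm_sum_Ioc_mul_le (fun n => (𝐞 ((d : ℝ) * S / n) : ℂ)) w hΦ0 ?_ (fun n => (norm_fourierChar _).le) ?_
  · intro k hAk hkB
    have : ∑ n ∈ Ioc A k, w n = ∑ n ∈ (Ioc A k).filter cond, weylC R n d := by
      rw [Finset.sum_filter]
    rw [this]; exact hΦ k hAk hkB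
  · have h := sum_norm_phase_sub_le d S hAB
    refine le_trans (le_of_eq ?_) h
    refine Finset.sum_congr rfl fun n _ => ?_
    push_cast
    ring_nf


/-! ### D-d. The type-I sum: trivial range and blocks -/

/-- `#{d : 0 < |d| ≤ H} = 2H`. [folklore] -/
theorem card_Icc_erase_zero (H : ℕ) : (((Icc (-(H : ℤ)) H).erase 0).card : ℝ) = 2 * H := by
  rw [Finset.card_erase_of_mem (by simp), Int.card_Icc]
  have : ((H : ℤ) + 1 - -(H : ℤ)).toNat = 2 * H + 1 := by omega
  rw [this]
  push_cast
  ring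

/-- **The fibres of the block map are progression-filtered intervals**: for `ℓ ≥ 1`, `Y ≥ 0`,
the `n ∈ (M₀, N₂]` with `cond n`, `(n − M₀ − 1)/ℓ = j` and `⌊Y/n⌋₊ = m` are exactly the `n` with
`cond n` in `(A', B']`, `A' = max(M₀ + jℓ, ⌊Y/(m+1)⌋₊)`,
`B' = min(M₀ + (j+1)ℓ, N₂)` capped by `⌊Y/m⌋₊` when `m ≥ 1`. [folklore] -/
theorem fiber_eq (cond : ℕ → Prop) [DecidablePred cond] {Y : ℝ} (hY : 0 ≤ Y) {ℓ : ℕ} (hℓ : 1 ≤ ℓ)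
    (M₀ N₂ j m : ℕ) :
    ((Ioc M₀ N₂).filter cond).filter
        (fun n => ((n - (M₀ + 1)) / ℓ, ⌊Y / n⌋₊) = (j, m)) =
      (Ioc (max (M₀ + j * ℓ) ⌊Y / ((m : ℝ) + 1)⌋₊)
          (if m = 0 then min (M₀ + (j + 1) * ℓ) N₂
            else min (min (M₀ + (j + 1) * ℓ) N₂) ⌊Y / (m : ℝ)⌋₊)).filter cond := by
  ext n
  simp only [Finset.mem_filter, Finset.mem_Ioc, Prod.mk.injEq]
  have hℓ0 : 0 < ℓ := hℓ
  constructor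
  · rintro ⟨⟨⟨hn1, hn2⟩, hc⟩, hj, hm⟩
    have hn0 : (0 : ℝ) < n := by exact_mod_cast (show 0 < n by omega)
    -- from `(n - (M₀+1))/ℓ = j`
    have hlo : j * ℓ ≤ n - (M₀ + 1) := (Nat.le_div_iff_mul_le hℓ0).mp hj.symm.le
    have hhi : n - (M₀ + 1) < (j + 1) * ℓ := (Nat.div_lt_iff_lt_mul hℓ0).mp (by omega)
    -- from `⌊Y/n⌋₊ = m`
    have hfl := (Nat.floor_eq_iff (by positivity : 0 ≤ Y / n)).mp hm
    have h1 : ⌊Y / ((m : ℝ) + 1)⌋₊ < n := by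
      rw [Nat.floor_lt (by positivity)]
      rw [div_lt_iff₀ (by positivity)]
      have := hfl.2; rw [div_lt_iff₀ hn0] at this; linarith
    refine ⟨⟨?_, ?_⟩, hc⟩
    · exact max_lt (by omega) h1
    · split_ifs with hm0
      · exact le_min (by omega) hn2
      · refine le_min (le_min (by omega) hn2) ?_
        rw [Nat.le_floor_iff (by positivity)]
        have hm0' : (0 : ℝ) < m := by exact_mod_cast Nat.pos_of_ne_zero hm0
        rw [le_div_iff₀ hm0']
        have := hfl.1; rw [le_div_iff₀ hn0] at this; linarith
  · rintro ⟨⟨hA, hB⟩, hc⟩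
    have hjl : M₀ + j * ℓ < n := lt_of_le_of_lt (le_max_left _ _) hA
    have hfl' : ⌊Y / ((m : ℝ) + 1)⌋₊ < n := lt_of_le_of_lt (le_max_right _ _) hA
    have hn0 : (0 : ℝ) < n := by exact_mod_cast (show 0 < n by omega)
    have hBN : n ≤ min (M₀ + (j + 1) * ℓ) N₂ := by
      split_ifs at hB with hm0
      · exact hB
      · exact le_trans hB (min_le_left _ _)
    have hB1 : n ≤ M₀ + (j + 1) * ℓ := le_trans hBN (min_le_left _ _)
    have hB2 : n ≤ N₂ := le_trans hBN (min_le_right _ _)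
    refine ⟨⟨⟨by omega, hB2⟩, hc⟩, ?_, ?_⟩
    · exact Nat.div_eq_of_lt_le (by omega) (by omega)
    · rw [Nat.floor_eq_iff (by positivity)]
      rw [Nat.floor_lt (by positivity), div_lt_iff₀ (by positivity)] at hfl'
      constructor
      · split_ifs at hB with hm0
        · rw [hm0]; push_cast; positivity
        · have hle : n ≤ ⌊Y / (m : ℝ)⌋₊ := le_trans hB (min_le_right _ _)
          have hm0' : (0 : ℝ) < m := by exact_mod_cast Nat.pos_of_ne_zero hm0
          rw [Nat.le_floor_iff (by positivity), le_div_iff₀ hm0'] at hle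
          rw [le_div_iff₀ hn0]; linarith
      · rw [div_lt_iff₀ hn0]; linarith

/-- **The type-I sum from level Weyl bounds (abstract form).**  Let `R(n)` be finite sets of
residues ("roots", with `∑_{n ≤ k} #R(n) ≤ C_ρ k`), `cond` a condition on the moduli, and assume the
Weyl sums `W̄_d(n) = ∑_{σ ∈ R(n)} e(−dσ/n)` satisfy `|∑_{k₁<n≤k₂, cond n} W̄_d(n)| ≤ Φ` for all
`0 < |d| ≤ H` and `N₀ ≤ k₁ ≤ k₂ ≤ N₂`.  Then for `Y > 0`, `S ∈ ℝ`, block length `ℓ ≥ 1` and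
`0 < δ ≤ 1/4 ≤ …`, `(H+1)δ ≥ 1`, the discrepancies `disc(n) = A(n) − (Y/n)#R(n)` of the counts
`A(n) = ∑_{σ ∈ R(n)} #{s ∈ (S − Y, S] : s ≡ σ (mod n)}` satisfy
`|∑_{N₁<n≤N₂, cond n} disc(n)| ≤ C_ρ N₀ + (Yℓ/N₀² + 2δ + 2/((H+1)δ)) C_ρ N₂
  + (N₂/ℓ + 1)(Y/N₀ + 1) · 2H (1 + 2π|S|ℓ/N₀²) Φ`
(trivial bound below `N₀`; above, blocks of length `ℓ` on which `⌊Y/n⌋` is constant, the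
Fejér-kernel counting inequalities, and Abel summation against `e(dS/n)`).
[cite: Hooley1967, §3 (the method, for `n² − D`)] -/
theorem abs_typeI_le (cond : ℕ → Prop) [DecidablePred cond] {S Y : ℝ} (hY : 0 < Y)
    {N₁ N₂ N₀ ℓ H : ℕ} (hN12 : N₁ ≤ N₂) (hℓ : 1 ≤ ℓ) (hN₀ : 1 ≤ N₀)
    {δ Φ Cρ : ℝ} (hδ : 0 < δ) (hδ4 : δ ≤ 1 / 4) (hHδ : 1 ≤ (H + 1) * δ) (hΦ0 : 0 ≤ Φ)
    (Hρ : ∀ k : ℕ, ∑ n ∈ Icc 1 k, ((R n).card : ℝ) ≤ Cρ * k)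
    (HW : ∀ d : ℤ, d ≠ 0 → |d| ≤ H → ∀ k₁ k₂ : ℕ, N₀ ≤ k₁ → k₁ ≤ k₂ → k₂ ≤ N₂ →
      ‖∑ n ∈ (Ioc k₁ k₂).filter cond, weylC R n d‖ ≤ Φ) :
    |∑ n ∈ (Ioc N₁ N₂).filter cond, disc R S Y n| ≤
      Cρ * N₀ + (Y * ℓ / (N₀ : ℝ) ^ 2 + 2 * δ + 2 / ((H + 1) * δ)) * (Cρ * N₂) +
        ((N₂ : ℝ) / ℓ + 1) * (Y / N₀ + 1) *
          (2 * H * (1 + 2 * Real.pi * |S| * ℓ / (N₀ : ℝ) ^ 2) * Φ) := by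
  classical
  obtain ⟨M₀, hM₀⟩ : ∃ M : ℕ, M = min N₂ (max N₁ N₀) := ⟨_, rfl⟩
  have hM₀N₂ : M₀ ≤ N₂ := by rw [hM₀]; exact min_le_left _ _
  have hN₁M₀ : N₁ ≤ M₀ := by rw [hM₀]; exact le_min hN12 (le_max_left _ _)
  have hN₀r : (0 : ℝ) < N₀ := by exact_mod_cast hN₀
  have hℓr : (0 : ℝ) < ℓ := by exact_mod_cast hℓ
  have hℓ1 : (1 : ℝ) ≤ ℓ := by exact_mod_cast hℓ
  -- ## splitting at `M₀`
  obtain ⟨part2, hpart2⟩ : ∃ P : Finset ℕ, P = (Ioc M₀ N₂).filter cond := ⟨_, rfl⟩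
  have hsplit : ∑ n ∈ (Ioc N₁ N₂).filter cond, disc R S Y n =
      ∑ n ∈ (Ioc N₁ M₀).filter cond, disc R S Y n + ∑ n ∈ part2, disc R S Y n := by
    rw [hpart2, Finset.sum_filter, Finset.sum_filter, Finset.sum_filter,
      Finset.sum_Ioc_consecutive _ hN₁M₀ hM₀N₂]
  -- ## the trivial range
  have hpart1 : |∑ n ∈ (Ioc N₁ M₀).filter cond, disc R S Y n| ≤ Cρ * N₀ := by
    refine (Finset.abs_sum_le_sum_abs _ _).trans ?_
    calc ∑ n ∈ (Ioc N₁ M₀).filter cond, |disc R S Y n|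
        ≤ ∑ n ∈ (Ioc N₁ M₀).filter cond, ((R n).card : ℝ) :=
          Finset.sum_le_sum fun n hn => abs_disc_le R S Y (by
            have := (Finset.mem_Ioc.mp (Finset.mem_filter.mp hn).1).1; omega)
      _ ≤ ∑ n ∈ Icc 1 N₀, ((R n).card : ℝ) := by
          refine Finset.sum_le_sum_of_subset_of_nonneg (fun n hn => ?_) fun _ _ _ =>
            Nat.cast_nonneg _
          have h := Finset.mem_Ioc.mp (Finset.mem_filter.mp hn).1
          rw [Finset.mem_Icc]
          rw [hM₀] at h
          omega
      _ ≤ Cρ * N₀ := Hρ N₀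
  -- ## the blocks
  have hM₀N₀ : ∀ n ∈ part2, N₀ ≤ M₀ ∧ N₀ + 1 ≤ n := by
    intro n hn
    rw [hpart2] at hn
    have h := Finset.mem_Ioc.mp (Finset.mem_filter.mp hn).1
    rw [hM₀] at h ⊢
    omega
  have hmem2 : ∀ n ∈ part2, M₀ < n ∧ n ≤ N₂ := by
    intro n hn
    rw [hpart2] at hn
    exact Finset.mem_Ioc.mp (Finset.mem_filter.mp hn).1
  obtain ⟨bm, hbm⟩ : ∃ f : ℕ → ℕ × ℕ, f = fun n => ((n - (M₀ + 1)) / ℓ, ⌊Y / n⌋₊) := ⟨_, rfl⟩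
  obtain ⟨J, hJ⟩ : ∃ J : ℕ, J = (N₂ - M₀) / ℓ + 1 := ⟨_, rfl⟩
  obtain ⟨Mm, hMm⟩ : ∃ M : ℕ, M = ⌊Y / ((N₀ : ℝ) + 1)⌋₊ := ⟨_, rfl⟩
  obtain ⟨I, hI⟩ : ∃ I : Finset (ℕ × ℕ), I = (Finset.range J) ×ˢ (Finset.range (Mm + 1)) :=
    ⟨_, rfl⟩
  have hmaps : ∀ n ∈ part2, bm n ∈ I := by
    intro n hn
    have ⟨hMN, hn1⟩ := hM₀N₀ n hn
    have h := hmem2 n hn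
    rw [hI, Finset.mem_product, Finset.mem_range, Finset.mem_range, hbm]
    dsimp only
    constructor
    · rw [hJ]
      have : (n - (M₀ + 1)) / ℓ ≤ (N₂ - M₀) / ℓ := Nat.div_le_div_right (by omega)
      omega
    · rw [hMm, Nat.lt_succ_iff]
      refine Nat.floor_mono ?_
      exact div_le_div_of_nonneg_left hY.le (by positivity) (by exact_mod_cast hn1)
  have hfib := (Finset.sum_fiberwise_of_maps_to hmaps (fun n => disc R S Y n)).symm
  have hfibN := (Finset.sum_fiberwise_of_maps_to hmaps (fun n => ((R n).card : ℝ))).symm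
  -- the constants
  obtain ⟨Wc, hWc⟩ : ∃ W : ℝ, W = 2 * H * (1 + 2 * Real.pi * |S| * ℓ / (N₀ : ℝ) ^ 2) * Φ :=
    ⟨_, rfl⟩
  have hWc0 : 0 ≤ Wc := by rw [hWc]; positivity
  obtain ⟨coef, hcoef⟩ : ∃ c : ℝ, c = Y * ℓ / (N₀ : ℝ) ^ 2 + 2 * δ + 2 / ((H + 1) * δ) :=
    ⟨_, rfl⟩
  have hcoef0 : 0 ≤ coef := by rw [hcoef]; positivity
  -- ## the bound on one fibre
  have hper : ∀ p ∈ I, |∑ n ∈ part2.filter (fun n => bm n = p), disc R S Y n| ≤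
      coef * (∑ n ∈ part2.filter (fun n => bm n = p), ((R n).card : ℝ)) + Wc := by
    rintro ⟨j, m⟩ _
    obtain ⟨fib, hfibdef⟩ : ∃ F : Finset ℕ, F = part2.filter (fun n => bm n = (j, m)) :=
      ⟨_, rfl⟩
    rw [← hfibdef]
    rcases fib.eq_empty_or_nonempty with h0 | hne
    · rw [h0, Finset.sum_empty, Finset.sum_empty, abs_zero, mul_zero, zero_add]
      exact hWc0
    obtain ⟨n₁, hn₁⟩ := hne
    have hn₁' : n₁ ∈ part2 := by
      rw [hfibdef] at hn₁; exact (Finset.mem_filter.mp hn₁).1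
    have hMN : N₀ ≤ M₀ := (hM₀N₀ n₁ hn₁').1
    -- membership facts
    have hmem : ∀ n ∈ fib, (M₀ + j * ℓ + 1 ≤ n ∧ n ≤ M₀ + (j + 1) * ℓ) ∧ n ≤ N₂ ∧
        ⌊Y / n⌋₊ = m ∧ N₀ + 1 ≤ n := by
      intro n hn
      rw [hfibdef, Finset.mem_filter] at hn
      obtain ⟨hn2, hbmn⟩ := hn
      rw [hbm] at hbmn
      simp only [Prod.mk.injEq] at hbmn
      have h := hmem2 n hn2
      have hℓ0 : 0 < ℓ := hℓ
      have hlo : j * ℓ ≤ n - (M₀ + 1) := (Nat.le_div_iff_mul_le hℓ0).mp hbmn.1.symm.le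
      have hhi : n - (M₀ + 1) < (j + 1) * ℓ := (Nat.div_lt_iff_lt_mul hℓ0).mp (by omega)
      exact ⟨⟨by omega, by omega⟩, h.2, hbmn.2, (hM₀N₀ n hn2).2⟩
    -- the block inequality
    obtain ⟨A, hA⟩ : ∃ A : ℝ, A = ((M₀ + j * ℓ : ℕ) : ℝ) := ⟨_, rfl⟩
    obtain ⟨B, hB⟩ : ∃ B : ℝ, B = ((M₀ + (j + 1) * ℓ : ℕ) : ℝ) := ⟨_, rfl⟩
    have hA0 : 0 < A + 1 := by rw [hA]; positivity
    have hAB : A + 1 ≤ B := by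
      rw [hA, hB]; push_cast; nlinarith
    have hblock := abs_sum_disc_le R S hY.le hA0 hAB (m : ℤ) fib (fun n hn => by
        obtain ⟨⟨h1, h2⟩, -, -, -⟩ := hmem n hn
        rw [hA, hB]
        exact ⟨by exact_mod_cast h1, by exact_mod_cast h2⟩)
      (fun n hn => by
        obtain ⟨-, -, h3, -⟩ := hmem n hn
        rw [← h3, Int.natCast_floor_eq_floor (by positivity)])
      H hδ hδ4 hHδ
    -- (i) the variation of `Y/n`
    have hvar : Y / (A + 1) - Y / B ≤ Y * ℓ / (N₀ : ℝ) ^ 2 := by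
      have hAN : (N₀ : ℝ) + 1 ≤ A + 1 := by
        rw [hA]; push_cast
        have : (N₀ : ℝ) ≤ M₀ := by exact_mod_cast hMN
        have : (0 : ℝ) ≤ j * ℓ := by positivity
        linarith
      have hBA : B - (A + 1) = ℓ - 1 := by rw [hA, hB]; push_cast; ring
      have hB0 : 0 < B := by linarith
      rw [div_sub_div _ _ hA0.ne' hB0.ne', div_le_div_iff₀ (by positivity) (by positivity)]
      have h1 : Y * B - (A + 1) * Y = Y * (ℓ - 1) := by rw [← hBA]; ring
      rw [h1]
      have hN₀A : (N₀ : ℝ) ≤ A + 1 := by linarith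
      have hN₀B : (N₀ : ℝ) ≤ B := by linarith
      have h2 : (N₀ : ℝ) ^ 2 ≤ (A + 1) * B := by
        rw [sq]; exact mul_le_mul hN₀A hN₀B hN₀r.le (by linarith)
      have h3 : Y * ((ℓ : ℝ) - 1) ≤ Y * ℓ := mul_le_mul_of_nonneg_left (by linarith) hY.le
      calc Y * ((ℓ : ℝ) - 1) * (N₀ : ℝ) ^ 2 ≤ Y * ℓ * (N₀ : ℝ) ^ 2 := by
            exact mul_le_mul_of_nonneg_right h3 (by positivity)
        _ ≤ Y * ℓ * ((A + 1) * B) := by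
            exact mul_le_mul_of_nonneg_left h2 (by positivity)
    -- (ii) the Weyl sums over the fibre
    have hweyl : ∀ d ∈ (Icc (-(H : ℤ)) H).erase 0,
        ‖∑ n ∈ fib, (𝐞 ((d : ℝ) * S / n) : ℂ) * weylC R n d‖ / |(d : ℝ)| ≤
          (1 + 2 * Real.pi * |S| * ℓ / (N₀ : ℝ) ^ 2) * Φ := by
      intro d hd
      rw [Finset.mem_erase, Finset.mem_Icc] at hd
      have hd1 : (1 : ℝ) ≤ |(d : ℝ)| := by
        rw [← Int.cast_abs]; exact_mod_cast Int.one_le_abs hd.1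
      -- the fibre as a filtered interval
      obtain ⟨A', hA'⟩ : ∃ A' : ℕ, A' = max (M₀ + j * ℓ) ⌊Y / ((m : ℝ) + 1)⌋₊ := ⟨_, rfl⟩
      obtain ⟨B', hB'⟩ : ∃ B' : ℕ, B' = (if m = 0 then min (M₀ + (j + 1) * ℓ) N₂
        else min (min (M₀ + (j + 1) * ℓ) N₂) ⌊Y / (m : ℝ)⌋₊) := ⟨_, rfl⟩
      have hfibeq : fib = (Ioc A' B').filter cond := by
        rw [hfibdef, hpart2, hA', hB', hbm]
        exact fiber_eq cond hY.le hℓ M₀ N₂ j m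
      have hn₁AB : A' < n₁ ∧ n₁ ≤ B' := by
        have := hn₁; rw [hfibeq, Finset.mem_filter, Finset.mem_Ioc] at this; exact this.1
      have hA'B' : A' + 1 ≤ B' := by omega
      have hA'ge : M₀ + j * ℓ ≤ A' := by rw [hA']; exact le_max_left _ _
      have hB'le : B' ≤ M₀ + (j + 1) * ℓ ∧ B' ≤ N₂ := by
        rw [hB']; split_ifs
        · exact ⟨min_le_left _ _, min_le_right _ _⟩
        · exact ⟨(min_le_left _ _).trans (min_le_left _ _),
            (min_le_left _ _).trans (min_le_right _ _)⟩
      have hN₀A' : N₀ ≤ A' := by omega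
      rw [hfibeq]
      have hbw := norm_blockWeyl_le R cond d S hA'B' hΦ0 (fun k hk1 hk2 =>
        HW d hd.1 (by rw [abs_le]; exact ⟨by linarith [hd.2.1], by exact_mod_cast hd.2.2⟩)
          A' k hN₀A' hk1 (hk2.trans hB'le.2))
      -- `1/(A'+1) − 1/B' ≤ ℓ/N₀²`
      have hgap : 1 / ((A' : ℝ) + 1) - 1 / (B' : ℝ) ≤ (ℓ : ℝ) / (N₀ : ℝ) ^ 2 := by
        have hA1 : (0 : ℝ) < (A' : ℝ) + 1 := by positivity
        have hB1 : (0 : ℝ) < B' := by exact_mod_cast (show 0 < B' by omega)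
        rw [div_sub_div _ _ hA1.ne' hB1.ne', div_le_div_iff₀ (by positivity) (by positivity)]
        have h1 : (B' : ℝ) - ((A' : ℝ) + 1) ≤ ℓ - 1 := by
          have hh1 : (B' : ℝ) ≤ ((M₀ + (j + 1) * ℓ : ℕ) : ℝ) := by exact_mod_cast hB'le.1
          have hh2 : ((M₀ + j * ℓ : ℕ) : ℝ) ≤ A' := by exact_mod_cast hA'ge
          push_cast at hh1 hh2
          linarith
        have hN₀A1 : (N₀ : ℝ) ≤ (A' : ℝ) + 1 := by
          have : (N₀ : ℝ) ≤ A' := by exact_mod_cast hN₀A'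
          linarith
        have hN₀B : (N₀ : ℝ) ≤ B' := by exact_mod_cast (show N₀ ≤ B' by omega)
        have h2 : (N₀ : ℝ) ^ 2 ≤ ((A' : ℝ) + 1) * B' := by
          rw [sq]; exact mul_le_mul hN₀A1 hN₀B hN₀r.le hA1.le
        calc (1 * (B' : ℝ) - ((A' : ℝ) + 1) * 1) * (N₀ : ℝ) ^ 2
            ≤ ((ℓ : ℝ) - 1) * (N₀ : ℝ) ^ 2 := by
              apply mul_le_mul_of_nonneg_right _ (by positivity); linarith
          _ ≤ (ℓ : ℝ) * (N₀ : ℝ) ^ 2 := mul_le_mul_of_nonneg_right (by linarith) (by positivity)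
          _ ≤ (ℓ : ℝ) * (((A' : ℝ) + 1) * B') := mul_le_mul_of_nonneg_left h2 hℓr.le
      rw [div_le_iff₀ (by linarith)]
      refine hbw.trans ?_
      have hSd : 0 ≤ 2 * Real.pi * |(d : ℝ)| * |S| := by positivity
      have h3 := mul_le_mul_of_nonneg_left hgap hSd
      calc (1 + 2 * Real.pi * |(d : ℝ)| * |S| * (1 / ((A' : ℝ) + 1) - 1 / B')) * Φ
          ≤ (|(d : ℝ)| + 2 * Real.pi * |(d : ℝ)| * |S| * ((ℓ : ℝ) / (N₀ : ℝ) ^ 2)) * Φ := by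
            apply mul_le_mul_of_nonneg_right _ hΦ0; linarith
        _ = (1 + 2 * Real.pi * |S| * ℓ / (N₀ : ℝ) ^ 2) * Φ * |(d : ℝ)| := by ring
    have hweylsum : ∑ d ∈ (Icc (-(H : ℤ)) H).erase 0,
        ‖∑ n ∈ fib, (𝐞 ((d : ℝ) * S / n) : ℂ) * weylC R n d‖ / |(d : ℝ)| ≤ Wc := by
      refine (Finset.sum_le_sum hweyl).trans ?_
      rw [Finset.sum_const, nsmul_eq_mul, card_Icc_erase_zero, hWc]
      exact le_of_eq (by ring)
    -- assemble
    obtain ⟨Np, hNp⟩ : ∃ x : ℝ, ∑ n ∈ fib, ((R n).card : ℝ) = x := ⟨_, rfl⟩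
    rw [hNp] at hblock ⊢
    have hNp0 : 0 ≤ Np := hNp ▸ Finset.sum_nonneg fun _ _ => Nat.cast_nonneg _
    have h1 := mul_le_mul_of_nonneg_right hvar hNp0
    rw [hcoef]
    have : (Y * ℓ / (N₀ : ℝ) ^ 2 + 2 * δ + 2 / ((H + 1) * δ)) * Np =
        Y * ℓ / (N₀ : ℝ) ^ 2 * Np + 2 * δ * Np + 2 * Np / ((H + 1) * δ) := by ring
    rw [this]
    linarith
  -- ## summing the fibres
  have hcardI : (I.card : ℝ) ≤ ((N₂ : ℝ) / ℓ + 1) * (Y / N₀ + 1) := by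
    rw [hI, Finset.card_product, Finset.card_range, Finset.card_range]
    push_cast
    have hJ' : (((N₂ - M₀) / ℓ : ℕ) : ℝ) ≤ (N₂ : ℝ) / ℓ := by
      refine Nat.cast_div_le.trans ?_
      exact div_le_div_of_nonneg_right (by exact_mod_cast Nat.sub_le N₂ M₀) hℓr.le
    have hM' : (Mm : ℝ) ≤ Y / N₀ := by
      rw [hMm]
      refine (Nat.floor_le (by positivity)).trans ?_
      exact div_le_div_of_nonneg_left hY.le hN₀r (by linarith)
    rw [hJ]
    push_cast
    have h2 : (0 : ℝ) ≤ (Mm : ℝ) + 1 := by positivity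
    calc ((((N₂ - M₀) / ℓ : ℕ) : ℝ) + 1) * ((Mm : ℝ) + 1)
        ≤ ((N₂ : ℝ) / ℓ + 1) * ((Mm : ℝ) + 1) := mul_le_mul_of_nonneg_right (by linarith) h2
      _ ≤ ((N₂ : ℝ) / ℓ + 1) * (Y / N₀ + 1) :=
          mul_le_mul_of_nonneg_left (by linarith) (by positivity)
  have hsumN : ∑ n ∈ part2, ((R n).card : ℝ) ≤ Cρ * N₂ := by
    calc ∑ n ∈ part2, ((R n).card : ℝ) ≤ ∑ n ∈ Icc 1 N₂, ((R n).card : ℝ) := by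
          refine Finset.sum_le_sum_of_subset_of_nonneg (fun n hn => ?_) fun _ _ _ =>
            Nat.cast_nonneg _
          have h := hmem2 n hn
          rw [Finset.mem_Icc]; omega
      _ ≤ Cρ * N₂ := Hρ N₂
  have hpart2' : |∑ n ∈ part2, disc R S Y n| ≤ coef * (Cρ * N₂) + (I.card : ℝ) * Wc := by
    rw [hfib]
    refine (Finset.abs_sum_le_sum_abs _ _).trans ?_
    refine (Finset.sum_le_sum hper).trans ?_
    rw [Finset.sum_add_distrib, Finset.sum_const, nsmul_eq_mul, ← Finset.mul_sum, ← hfibN]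
    have := mul_le_mul_of_nonneg_left hsumN hcoef0
    linarith
  -- ## conclusion
  rw [hsplit]
  refine (abs_add_le _ _).trans ?_
  have hIW := mul_le_mul_of_nonneg_right hcardI hWc0
  rw [hcoef, hWc] at hpart2'
  rw [hWc] at hIW
  linarith [hpart1, hpart2', hIW]


/-! ### D-e. The congruence count in a progression, as a count over roots -/

section Count

open Polynomial

variable (G : ℤ[X])

/-- The roots of `G` modulo `n`, as a finset of `{0, …, n−1}`. [folklore] -/
def rootSet (n : ℕ) : Finset ℕ := (Finset.range n).filter (fun ν => (n : ℤ) ∣ G.eval (ν : ℤ))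

/-- `#rootSet G n = ρ_G(n)`. [folklore] -/
theorem card_rootSet (n : ℕ) : (rootSet G n).card = polyRootCountMod ![G] n := by
  unfold rootSet polyRootCountMod
  congr 1
  refine Finset.filter_congr fun ν _ => ?_
  simp

/-- `rootSet G n ⊆ range n`. [folklore] -/
theorem rootSet_subset (n : ℕ) : rootSet G n ⊆ Finset.range n := Finset.filter_subset _ _

/-- `n ∣ G(s) ↔ n ∣ G(t)` for `s ≡ t (mod n)`. [folklore] -/
theorem dvd_eval_iff_of_modEq {n : ℕ} {s t : ℤ} (h : s ≡ t [ZMOD n]) :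
    (n : ℤ) ∣ G.eval s ↔ (n : ℤ) ∣ G.eval t := by
  have h1 : s - t ∣ G.eval s - G.eval t := Polynomial.sub_dvd_eval_sub s t G
  have h2 : (n : ℤ) ∣ s - t := (Int.ModEq.dvd h.symm)
  exact (dvd_iff_dvd_of_dvd_sub (h2.trans h1))

/-- **The count in a residue class of a progression**: for `0 ≤ L`-ish data — precisely, for a
residue `σ < n` (`n ≥ 1`), reals `L' > -1`... we use: the `s ∈ ℕ` with `s ≡ σ (mod n)` and
`Lr < s ≤ Ur` (reals, `Lr ≥ 0`) are counted by `⌊(Ur − σ)/n⌋ − ⌊(Lr − σ)/n⌋`. [folklore] -/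
theorem card_filter_mod_eq {n : ℕ} (hn : 0 < n) {σ : ℕ} (hσ : σ < n) {Lr Ur : ℝ} (hL : 0 ≤ Lr)
    (hLU : Lr ≤ Ur) (M : ℕ) (hM : Ur < M) :
    ((((Finset.range M).filter (fun s : ℕ => Lr < s ∧ (s : ℝ) ≤ Ur ∧ s % n = σ)).card : ℕ) : ℤ) =
      ⌊(Ur - σ) / n⌋ - ⌊(Lr - σ) / n⌋ := by
  have hn' : (0 : ℝ) < n := by exact_mod_cast hn
  have hσ' : (σ : ℝ) < n := by exact_mod_cast hσ
  set U : ℝ := (Ur - σ) / n with hU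
  set L : ℝ := (Lr - σ) / n with hLdef
  have hLm1 : (-1 : ℝ) < L := by
    rw [hLdef, lt_div_iff₀ hn']; linarith
  have hfloorL : (-1 : ℤ) ≤ ⌊L⌋ := by
    rw [Int.le_floor]; push_cast; linarith
  have hLU' : L ≤ U := by
    rw [hLdef, hU]; exact div_le_div_of_nonneg_right (by linarith) hn'.le
  -- the bijection with the integers `k`, `L < k ≤ U`
  have hcard : ((Finset.range M).filter (fun s : ℕ => Lr < s ∧ (s : ℝ) ≤ Ur ∧ s % n = σ)).card =
      (Finset.Ioc ⌊L⌋ ⌊U⌋).card := by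
    refine Finset.card_nbij' (fun s : ℕ => ((s / n : ℕ) : ℤ)) (fun k : ℤ => n * k.toNat + σ)
      ?_ ?_ ?_ ?_
    · intro s hs
      dsimp only
      rw [Finset.mem_coe, Finset.mem_filter, Finset.mem_range] at hs
      obtain ⟨-, h1, h2, h3⟩ := hs
      have hsdec : (s : ℝ) = n * ((s / n : ℕ) : ℝ) + σ := by
        have := Nat.div_add_mod s n
        rw [h3] at this
        exact_mod_cast this.symm
      rw [Finset.mem_coe, Finset.mem_Ioc, Int.floor_lt, Int.le_floor, Int.cast_natCast]
      constructor
      · rw [hLdef, div_lt_iff₀ hn']; linarith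
      · rw [hU, le_div_iff₀ hn']; linarith
    · intro k hk
      dsimp only
      rw [Finset.mem_coe, Finset.mem_Ioc] at hk
      have hk0 : 0 ≤ k := by omega
      have hkr : ((k.toNat : ℕ) : ℝ) = (k : ℝ) := by
        have : ((k.toNat : ℕ) : ℤ) = k := Int.toNat_of_nonneg hk0
        exact_mod_cast this
      have h1 : L < k := Int.floor_lt.mp hk.1
      have h2 : (k : ℝ) ≤ U := Int.le_floor.mp hk.2
      rw [hLdef, div_lt_iff₀ hn'] at h1
      rw [hU, le_div_iff₀ hn'] at h2
      rw [Finset.mem_coe, Finset.mem_filter, Finset.mem_range]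
      have hsr : ((n * k.toNat + σ : ℕ) : ℝ) = n * (k : ℝ) + σ := by push_cast; rw [hkr]
      refine ⟨?_, ?_, ?_, ?_⟩
      · have : ((n * k.toNat + σ : ℕ) : ℝ) < M := by rw [hsr]; linarith
        exact_mod_cast this
      · rw [hsr]; linarith
      · rw [hsr]; linarith
      · rw [Nat.mul_add_mod_self_left, Nat.mod_eq_of_lt hσ]
    · intro s hs
      dsimp only
      rw [Finset.mem_coe, Finset.mem_filter] at hs
      have := Nat.div_add_mod s n
      rw [hs.2.2.2] at this
      simp only [Int.toNat_natCast]
      exact this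
    · intro k hk
      rw [Finset.mem_coe, Finset.mem_Ioc] at hk
      have hk0 : 0 ≤ k := by omega
      dsimp only
      rw [Nat.mul_add_div hn, Nat.div_eq_of_lt hσ, add_zero, Int.toNat_of_nonneg hk0]
  rw [hcard, Int.card_Ioc, Int.toNat_of_nonneg]
  exact sub_nonneg.mpr (Int.floor_mono hLU')

/-- **The congruence count in a progression as a count over the roots of `G = P(qX + b₁)`**:
for `q ≥ 1`, `b₁ < q`, `b₁ ≤ y` and `n ≥ 1`,
`#{y < t ≤ 2y : t ≡ b₁ (mod q), n ∣ P(t)} = ∑_{σ root of G mod n} (⌊(S−σ)/n⌋ − ⌊(S−Y−σ)/n⌋)`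
with `S = (2y − b₁)/q`, `Y = y/q` (substitute `t = q s + b₁` and count the `s ≡ σ (mod n)` in
`(S − Y, S]`). [folklore] -/
theorem card_progression_eq (P : ℤ[X]) {q : ℕ} (hq : 0 < q) {b₁ : ℕ} (hb : b₁ < q) {y : ℕ}
    (hy : b₁ ≤ y) {n : ℕ} (hn : 0 < n) :
    ((((Finset.Ioc y (2 * y)).filter (fun t : ℕ => t % q = b₁ ∧ (n : ℤ) ∣ P.eval (t : ℤ))).card
        : ℕ) : ℤ) =
      ∑ σ ∈ rootSet (P.comp (C (q : ℤ) * X + C (b₁ : ℤ))) n,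
        (⌊((2 * (y : ℝ) - b₁) / q - σ) / n⌋ - ⌊((2 * (y : ℝ) - b₁) / q - (y : ℝ) / q - σ) / n⌋) := by
  set G : ℤ[X] := P.comp (C (q : ℤ) * X + C (b₁ : ℤ)) with hGdef
  have hG : ∀ s : ℤ, G.eval s = P.eval (q * s + b₁) := by
    intro s; rw [hGdef, eval_comp]; simp
  have hq' : (0 : ℝ) < q := by exact_mod_cast hq
  -- Step A: `t = q s + b₁`
  set T := (Finset.Ioc y (2 * y)).filter (fun t : ℕ => t % q = b₁ ∧ (n : ℤ) ∣ P.eval (t : ℤ))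
    with hT
  set S' := (Finset.range (2 * y + 1)).filter (fun s : ℕ => y < q * s + b₁ ∧ q * s + b₁ ≤ 2 * y ∧
    (n : ℤ) ∣ G.eval (s : ℤ)) with hS'
  have hA : T.card = S'.card := by
    refine Finset.card_nbij' (fun t => t / q) (fun s => q * s + b₁) ?_ ?_ ?_ ?_
    · intro t ht
      dsimp only
      rw [Finset.mem_coe, hT, Finset.mem_filter, Finset.mem_Ioc] at ht
      obtain ⟨⟨h1, h2⟩, h3, h4⟩ := ht
      have hdec : q * (t / q) + b₁ = t := by
        have := Nat.div_add_mod t q; rw [h3] at this; exact this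
      rw [Finset.mem_coe, hS', Finset.mem_filter, Finset.mem_range]
      refine ⟨?_, by omega, by omega, ?_⟩
      · have : t / q ≤ t := Nat.div_le_self t q
        omega
      · rw [hG]
        have : ((q : ℤ) * ((t / q : ℕ) : ℤ) + b₁) = (t : ℤ) := by exact_mod_cast hdec
        rw [this]; exact h4
    · intro s hs
      dsimp only
      rw [Finset.mem_coe, hS', Finset.mem_filter, Finset.mem_range] at hs
      obtain ⟨-, h1, h2, h3⟩ := hs
      rw [Finset.mem_coe, hT, Finset.mem_filter, Finset.mem_Ioc]
      refine ⟨⟨h1, h2⟩, ?_, ?_⟩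
      · rw [Nat.mul_add_mod, Nat.mod_eq_of_lt hb]
      · rw [hG] at h3; push_cast at h3 ⊢; exact h3
    · intro t ht
      dsimp only
      rw [Finset.mem_coe, hT, Finset.mem_filter] at ht
      have := Nat.div_add_mod t q; rw [ht.2.1] at this; exact this
    · intro s _
      dsimp only
      rw [Nat.mul_add_div hq, Nat.div_eq_of_lt hb, add_zero]
  -- Step B: fibres `s mod n`
  set W : ℕ → Finset ℕ := fun σ => (Finset.range (2 * y + 1)).filter (fun s : ℕ =>
    (((y : ℝ) - b₁) / q) < s ∧ (s : ℝ) ≤ (2 * (y : ℝ) - b₁) / q ∧ s % n = σ) with hW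
  have hcond : ∀ s : ℕ, (y < q * s + b₁ ∧ q * s + b₁ ≤ 2 * y) ↔
      ((((y : ℝ) - b₁) / q) < s ∧ (s : ℝ) ≤ (2 * (y : ℝ) - b₁) / q) := by
    intro s
    rw [div_lt_iff₀ hq', le_div_iff₀ hq']
    constructor
    · rintro ⟨h1, h2⟩
      constructor
      · have : (y : ℝ) < q * s + b₁ := by exact_mod_cast h1
        linarith
      · have : (q : ℝ) * s + b₁ ≤ 2 * y := by exact_mod_cast h2
        linarith
    · rintro ⟨h1, h2⟩
      constructor
      · have : (y : ℝ) < (q * s + b₁ : ℕ) := by push_cast; linarith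
        exact_mod_cast this
      · have : ((q * s + b₁ : ℕ) : ℝ) ≤ (2 * y : ℕ) := by push_cast; linarith
        exact_mod_cast this
  have hB : S'.card = ∑ σ ∈ rootSet G n, (W σ).card := by
    rw [Finset.card_eq_sum_card_fiberwise (f := fun s => s % n) (t := Finset.range n)
      (fun s _ => Finset.mem_range.mpr (Nat.mod_lt s hn))]
    rw [rootSet, Finset.sum_filter]
    refine Finset.sum_congr rfl fun σ hσ => ?_
    rw [Finset.mem_range] at hσ
    have hfib : S'.filter (fun s => s % n = σ) = if (n : ℤ) ∣ G.eval (σ : ℤ) then W σ else ∅ := by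
      ext s
      rw [hS', Finset.mem_filter, Finset.mem_filter, Finset.mem_range]
      have hmod : ∀ s : ℕ, s % n = σ → ((n : ℤ) ∣ G.eval (s : ℤ) ↔ (n : ℤ) ∣ G.eval (σ : ℤ)) := by
        intro s hs
        refine dvd_eval_iff_of_modEq G ?_
        rw [Int.ModEq, ← hs]; push_cast; rw [Int.emod_emod_of_dvd _ (dvd_refl _)]
      split_ifs with hroot
      · rw [hW, Finset.mem_filter, Finset.mem_range]
        constructor
        · rintro ⟨⟨h0, h1, h2, h3⟩, h4⟩
          exact ⟨h0, ((hcond s).mp ⟨h1, h2⟩).1, ((hcond s).mp ⟨h1, h2⟩).2, h4⟩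
        · rintro ⟨h0, h1, h2, h4⟩
          exact ⟨⟨h0, ((hcond s).mpr ⟨h1, h2⟩).1, ((hcond s).mpr ⟨h1, h2⟩).2,
            (hmod s h4).mpr hroot⟩, h4⟩
      · simp only [Finset.notMem_empty, iff_false]
        rintro ⟨⟨-, -, -, h3⟩, h4⟩
        exact hroot ((hmod s h4).mp h3)
    rw [hfib]
    split_ifs <;> simp
  -- Step C: each fibre
  have hC : ∀ σ ∈ rootSet G n, (((W σ).card : ℕ) : ℤ) =
      ⌊((2 * (y : ℝ) - b₁) / q - σ) / n⌋ - ⌊((2 * (y : ℝ) - b₁) / q - (y : ℝ) / q - σ) / n⌋ := by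
    intro σ hσ
    have hσn : σ < n := Finset.mem_range.mp (rootSet_subset G n hσ)
    have hyb : (0 : ℝ) ≤ ((y : ℝ) - b₁) / q := by
      apply div_nonneg _ hq'.le
      have : (b₁ : ℝ) ≤ y := by exact_mod_cast hy
      linarith
    have hLU : ((y : ℝ) - b₁) / q ≤ (2 * (y : ℝ) - b₁) / q :=
      div_le_div_of_nonneg_right (by have : (0:ℝ) ≤ y := Nat.cast_nonneg y; linarith) hq'.le
    have hM : (2 * (y : ℝ) - b₁) / q < ((2 * y + 1 : ℕ) : ℝ) := by
      rw [div_lt_iff₀ hq']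
      have hq1 : (1 : ℝ) ≤ q := by exact_mod_cast hq
      have hy0 : (0 : ℝ) ≤ y := Nat.cast_nonneg y
      have hb0 : (0 : ℝ) ≤ b₁ := Nat.cast_nonneg b₁
      push_cast
      nlinarith
    have h := card_filter_mod_eq hn hσn hyb hLU (2 * y + 1) hM
    rw [hW]
    rw [h]
    congr 2
    ring
  rw [hA, hB]
  push_cast
  exact Finset.sum_congr rfl hC

end Count


/-! ### D-f. The root count and the Weyl sums of `G = P(qX + b₁)`; Möbius and levels -/

section Bridge

open Polynomial
open scoped ArithmeticFunction.Moebius ArithmeticFunction.zeta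

/-- **`ρ_G(n) = ρ_P(n)` for `(n, q) = 1`**, `G = P(qX + b₁)`: `x ↦ qx + b₁` permutes `ℤ/nℤ`.
[folklore] -/
theorem card_rootSet_comp_eq (P : ℤ[X]) {q b₁ n : ℕ} (hn : 0 < n) (hqn : q.Coprime n) :
    (rootSet (P.comp (C (q : ℤ) * X + C (b₁ : ℤ))) n).card = (rootSet P n).card := by
  haveI : NeZero n := ⟨hn.ne'⟩
  rw [card_rootSet, card_rootSet, ← card_polyRootsMod, ← card_polyRootsMod]
  set u : (ZMod n)ˣ := ZMod.unitOfCoprime q hqn with hu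
  have hu' : ((u : ZMod n)) = (q : ZMod n) := ZMod.coe_unitOfCoprime q hqn
  set φ := Int.castRingHom (ZMod n) with hφ
  have hmap : (P.comp (C (q : ℤ) * X + C (b₁ : ℤ))).map φ =
      (P.map φ).comp (C (q : ZMod n) * X + C (b₁ : ZMod n)) := by
    rw [Polynomial.map_comp]; simp
  have heval : ∀ x : ZMod n, ((P.comp (C (q : ℤ) * X + C (b₁ : ℤ))).map φ).eval x =
      (P.map φ).eval ((q : ZMod n) * x + b₁) := by
    intro x; rw [hmap, eval_comp]; simp
  refine Finset.card_nbij' (fun x : ZMod n => (q : ZMod n) * x + b₁)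
    (fun z : ZMod n => (↑(u⁻¹) : ZMod n) * (z - b₁)) ?_ ?_ ?_ ?_
  · intro x hx
    rw [Finset.mem_coe, mem_polyRootsMod] at hx ⊢
    rwa [heval] at hx
  · intro z hz
    rw [Finset.mem_coe, mem_polyRootsMod] at hz ⊢
    rw [heval]
    have : (q : ZMod n) * ((↑(u⁻¹) : ZMod n) * (z - b₁)) + b₁ = z := by
      rw [← mul_assoc, ← hu', Units.mul_inv, one_mul, sub_add_cancel]
    rw [this]; exact hz
  · intro x _
    dsimp only
    rw [add_sub_cancel_right, ← mul_assoc, ← hu', Units.inv_mul, one_mul]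
  · intro z _
    dsimp only
    rw [← mul_assoc, ← hu', Units.mul_inv, one_mul, sub_add_cancel]

/-- **The conjugate Weyl sum of the root set is the tree's `polyRootWeylSum` at `−d`.**
[folklore] -/
theorem weylC_rootSet (G : ℤ[X]) (n : ℕ) (d : ℤ) :
    weylC (rootSet G) n d = polyRootWeylSum G n (-d) := by
  unfold weylC polyRootWeylSum rootSet
  refine Finset.sum_congr rfl fun σ _ => ?_
  rw [Real.fourierChar_apply]
  congr 1
  push_cast
  ring

/-- `∑_{e ∣ m} μ(e) = [m = 1]` in `ℂ`. [folklore] -/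
theorem sum_divisors_moebius_complex (m : ℕ) :
    ∑ e ∈ m.divisors, (μ e : ℂ) = if m = 1 then 1 else 0 := by
  have h := congrArg (fun f : ArithmeticFunction ℂ => f m)
    (ArithmeticFunction.coe_moebius_mul_coe_zeta : (μ * ζ : ArithmeticFunction ℂ) = 1)
  simp only [ArithmeticFunction.coe_mul_zeta_apply, ArithmeticFunction.intCoe_apply,
    ArithmeticFunction.one_apply] at h
  exact h

/-- **Möbius detection of coprimality** (complex weights): for `Q ≠ 0`,
`∑_{k ∈ A, (k,Q)=1} f(k) = ∑_{e ∣ Q} μ(e) ∑_{k ∈ A, e ∣ k} f(k)`. [folklore] -/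
theorem sum_filter_coprime_eq_sum_moebius_complex {Q : ℕ} (hQ : Q ≠ 0) (A : Finset ℕ)
    (f : ℕ → ℂ) :
    ∑ k ∈ A.filter (fun k => k.Coprime Q), f k =
      ∑ e ∈ Q.divisors, (μ e : ℂ) * ∑ k ∈ A.filter (e ∣ ·), f k := by
  have hswap : ∑ e ∈ Q.divisors, (μ e : ℂ) * ∑ k ∈ A.filter (e ∣ ·), f k =
      ∑ k ∈ A, f k * ∑ e ∈ Q.divisors.filter (· ∣ k), (μ e : ℂ) := by
    have h1 : ∀ e ∈ Q.divisors, (μ e : ℂ) * ∑ k ∈ A.filter (e ∣ ·), f k =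
        ∑ k ∈ A, if e ∣ k then (μ e : ℂ) * f k else 0 := by
      intro e _
      rw [Finset.sum_filter, Finset.mul_sum]
      refine Finset.sum_congr rfl fun k _ => ?_
      split_ifs <;> simp
    rw [Finset.sum_congr rfl h1, Finset.sum_comm]
    refine Finset.sum_congr rfl fun k _ => ?_
    rw [Finset.sum_filter, Finset.mul_sum]
    refine Finset.sum_congr rfl fun e _ => ?_
    split_ifs <;> ring
  rw [hswap, Finset.sum_filter]
  refine Finset.sum_congr rfl fun k _ => ?_
  have hset : Q.divisors.filter (· ∣ k) = (Q.gcd k).divisors := by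
    ext e
    simp only [Finset.mem_filter, Nat.mem_divisors, Nat.dvd_gcd_iff]
    constructor
    · rintro ⟨⟨h1, -⟩, h2⟩; exact ⟨⟨h1, h2⟩, Nat.gcd_ne_zero_left hQ⟩
    · rintro ⟨⟨h1, h2⟩, -⟩; exact ⟨⟨h1, hQ⟩, h2⟩
  rw [hset, sum_divisors_moebius_complex]
  have hiff : Q.gcd k = 1 ↔ k.Coprime Q := by rw [Nat.Coprime, Nat.gcd_comm]
  by_cases hc : k.Coprime Q
  · rw [if_pos hc, if_pos (hiff.mpr hc), mul_one]
  · rw [if_neg hc, if_neg (fun h1 => hc (hiff.mp h1)), mul_zero]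

/-- Sums over `(k₁, k₂] ∩ Lℕ` are differences of the prefix sums over `[1, k] ∩ Lℕ`. [folklore] -/
theorem sum_Ioc_filter_dvd_eq_sub {M : Type*} [AddCommGroup M] (L : ℕ) {k₁ k₂ : ℕ} (hk : k₁ ≤ k₂)
    (f : ℕ → M) :
    ∑ n ∈ (Finset.Ioc k₁ k₂).filter (L ∣ ·), f n =
      ∑ n ∈ (Finset.Icc 1 k₂).filter (L ∣ ·), f n - ∑ n ∈ (Finset.Icc 1 k₁).filter (L ∣ ·), f n := by
  have hIcc : ∀ k : ℕ, Finset.Icc 1 k = Finset.Ioc 0 k := fun k => by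
    ext n; simp only [Finset.mem_Icc, Finset.mem_Ioc]; omega
  rw [hIcc, hIcc, Finset.sum_filter, Finset.sum_filter, Finset.sum_filter,
    ← Finset.sum_Ioc_consecutive _ (Nat.zero_le k₁) hk]
  abel

/-- Sums over `(k₁, k₂]` with a condition are differences of the conditioned prefix sums.
[folklore] -/
theorem sum_Ioc_filter_eq_sub {M : Type*} [AddCommGroup M] (p : ℕ → Prop) [DecidablePred p]
    {k₁ k₂ : ℕ} (hk : k₁ ≤ k₂) (f : ℕ → M) :
    ∑ n ∈ (Finset.Ioc k₁ k₂).filter p, f n =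
      ∑ n ∈ (Finset.Icc 1 k₂).filter p, f n - ∑ n ∈ (Finset.Icc 1 k₁).filter p, f n := by
  have hIcc : ∀ k : ℕ, Finset.Icc 1 k = Finset.Ioc 0 k := fun k => by
    ext n; simp only [Finset.mem_Icc, Finset.mem_Ioc]; omega
  rw [hIcc, hIcc, Finset.sum_filter, Finset.sum_filter, Finset.sum_filter,
    ← Finset.sum_Ioc_consecutive _ (Nat.zero_le k₁) hk]
  abel

/-- **Level sums with a coprimality condition from the level Weyl bound**: if
`|∑_{n ≤ x, L ∣ n} S_G(n, h)| ≤ K (1+|h|)^C L^C x^{1−δ₀}` for all `x`, `L ≥ 1`, `h ≠ 0`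
(`0 ≤ K, C`, `δ₀ ≤ 1`), then for `Q ≠ 0`, `ℓ ≥ 1`, `h ≠ 0` and `k₁ ≤ k₂`,
`|∑_{k₁<n≤k₂, ℓ∣n, (n,Q)=1} S_G(n, h)| ≤ 2 τ(Q) K (1+|h|)^C (ℓQ)^C k₂^{1−δ₀}` (Möbius over
`e ∣ Q`, levels `lcm(ℓ, e) ≤ ℓQ`, differences of prefix sums). [folklore] -/
theorem norm_sum_level_coprime_le (G : ℤ[X]) {K C δ₀ : ℝ} (hK : 0 ≤ K) (hC : 0 ≤ C) (hδ₀ : δ₀ ≤ 1)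
    (HWL : ∀ x L : ℕ, 1 ≤ L → ∀ h : ℤ, h ≠ 0 →
      ‖∑ n ∈ (Finset.Icc 1 x).filter (L ∣ ·), polyRootWeylSum G n h‖ ≤
        K * (1 + |(h : ℝ)|) ^ C * (L : ℝ) ^ C * (x : ℝ) ^ (1 - δ₀))
    {Q : ℕ} (hQ : Q ≠ 0) {ℓ : ℕ} (hℓ : 1 ≤ ℓ) {h : ℤ} (hh : h ≠ 0) {k₁ k₂ : ℕ} (hk : k₁ ≤ k₂) :
    ‖∑ n ∈ (Finset.Ioc k₁ k₂).filter (fun n => ℓ ∣ n ∧ n.Coprime Q), polyRootWeylSum G n h‖ ≤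
      2 * (Q.divisors.card : ℝ) * K * (1 + |(h : ℝ)|) ^ C * (((ℓ * Q : ℕ)) : ℝ) ^ C *
        (k₂ : ℝ) ^ (1 - δ₀) := by
  have hsplit : (Finset.Ioc k₁ k₂).filter (fun n => ℓ ∣ n ∧ n.Coprime Q) =
      ((Finset.Ioc k₁ k₂).filter (ℓ ∣ ·)).filter (fun n => n.Coprime Q) := by
    rw [Finset.filter_filter]
  rw [hsplit, sum_filter_coprime_eq_sum_moebius_complex hQ]
  set B : ℝ := K * (1 + |(h : ℝ)|) ^ C * (((ℓ * Q : ℕ)) : ℝ) ^ C * (k₂ : ℝ) ^ (1 - δ₀) with hB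
  have hB0 : 0 ≤ B := by rw [hB]; positivity
  have hterm : ∀ e ∈ Q.divisors,
      ‖(μ e : ℂ) * ∑ n ∈ ((Finset.Ioc k₁ k₂).filter (ℓ ∣ ·)).filter (e ∣ ·), polyRootWeylSum G n h‖ ≤
        2 * B := by
    intro e he
    have he0 : 0 < e := Nat.pos_of_mem_divisors he
    have heQ : e ≤ Q := Nat.divisor_le he
    rw [norm_mul]
    have hμ : ‖(μ e : ℂ)‖ ≤ 1 := by
      rw [Complex.norm_intCast]; exact_mod_cast ArithmeticFunction.abs_moebius_le_one
    -- the level `lcm ℓ e`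
    set L := Nat.lcm ℓ e with hL
    have hL1 : 1 ≤ L := Nat.one_le_iff_ne_zero.mpr (Nat.lcm_ne_zero (by omega) he0.ne')
    have hLle : L ≤ ℓ * Q := by
      have h1 : L ≤ ℓ * e := Nat.le_of_dvd (Nat.mul_pos (by omega) he0) (Nat.lcm_dvd_mul ℓ e)
      exact h1.trans (Nat.mul_le_mul_left _ heQ)
    have hfilt : ((Finset.Ioc k₁ k₂).filter (ℓ ∣ ·)).filter (e ∣ ·) =
        (Finset.Ioc k₁ k₂).filter (L ∣ ·) := by
      rw [Finset.filter_filter]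
      refine Finset.filter_congr fun n _ => ?_
      rw [hL, Nat.lcm_dvd_iff]
    rw [hfilt, sum_Ioc_filter_dvd_eq_sub L hk]
    have hp : ∀ k : ℕ, k ≤ k₂ → ‖∑ n ∈ (Finset.Icc 1 k).filter (L ∣ ·), polyRootWeylSum G n h‖ ≤ B := by
      intro k hkk
      refine (HWL k L hL1 h hh).trans ?_
      rw [hB]
      have h1 : (L : ℝ) ^ C ≤ (((ℓ * Q : ℕ)) : ℝ) ^ C :=
        Real.rpow_le_rpow (Nat.cast_nonneg _) (by exact_mod_cast hLle) hC
      have h2 : (k : ℝ) ^ (1 - δ₀) ≤ (k₂ : ℝ) ^ (1 - δ₀) :=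
        Real.rpow_le_rpow (Nat.cast_nonneg _) (by exact_mod_cast hkk) (by linarith)
      have h3 : 0 ≤ K * (1 + |(h : ℝ)|) ^ C := by positivity
      calc K * (1 + |(h : ℝ)|) ^ C * (L : ℝ) ^ C * (k : ℝ) ^ (1 - δ₀)
          ≤ K * (1 + |(h : ℝ)|) ^ C * (((ℓ * Q : ℕ)) : ℝ) ^ C * (k : ℝ) ^ (1 - δ₀) := by
            apply mul_le_mul_of_nonneg_right _ (by positivity)
            exact mul_le_mul_of_nonneg_left h1 h3
        _ ≤ _ := by
            apply mul_le_mul_of_nonneg_left h2; positivity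
    calc ‖(μ e : ℂ)‖ * ‖∑ n ∈ (Finset.Icc 1 k₂).filter (L ∣ ·), polyRootWeylSum G n h -
          ∑ n ∈ (Finset.Icc 1 k₁).filter (L ∣ ·), polyRootWeylSum G n h‖
        ≤ 1 * (B + B) := by
          refine mul_le_mul hμ ((norm_sub_le _ _).trans (add_le_add (hp k₂ le_rfl) (hp k₁ hk)))
            (norm_nonneg _) zero_le_one
      _ = 2 * B := by ring
  refine (norm_sum_le _ _).trans ((Finset.sum_le_sum hterm).trans ?_)
  rw [Finset.sum_const, nsmul_eq_mul, hB]
  ring_nf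
  exact le_refl _

end Bridge


/-! ### D-g. The type-I hypothesis from the level Weyl bound -/

section Final

open Polynomial

/-- `rootSet (g·F) n = rootSet F n` for `(n, g) = 1`. [folklore] -/
theorem rootSet_C_mul {g : ℤ} (F : ℤ[X]) {n : ℕ} (hn : n.Coprime g.natAbs) :
    rootSet (C g * F) n = rootSet F n := by
  unfold rootSet
  refine Finset.filter_congr fun ν _ => ?_
  rw [eval_mul, eval_C]
  have hcop : IsCoprime (n : ℤ) g := by
    rw [Int.isCoprime_iff_gcd_eq_one, Int.gcd_eq_natAbs, Int.natAbs_natCast]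
    exact hn
  exact ⟨fun h => hcop.dvd_of_dvd_mul_left h, fun h => Dvd.dvd.mul_left h g⟩

/-- `⌊x⌋₊ ≥ x/2` for `x ≥ 2`. [folklore] -/
theorem half_le_floor {x : ℝ} (hx : 2 ≤ x) : x / 2 ≤ ⌊x⌋₊ := by
  have := Nat.lt_floor_add_one x
  linarith

/-- **The sum of `#R(n)` over `n ≤ k`** for `R(n) = rootSet G n` on `(n, Q) = 1` (else `∅`),
`G = P(qX + b₁)`, `P = g P₀` with `P₀` irreducible: `≤ C k`. [folklore] -/
theorem exists_sum_card_roots_le (P : ℤ[X]) (hirr : Irreducible (P.map (Int.castRingHom ℚ)))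
    (hdeg : 0 < P.natDegree) :
    ∃ Cρ : ℝ, 0 < Cρ ∧ ∀ q b₁ Q : ℕ, (∀ p : ℕ, p.Prime → p ∣ q → p ∣ Q) →
      (∀ p : ℕ, p.Prime → (p : ℤ) ∣ P.content → p ∣ Q) →
      ∀ k : ℕ, ∑ n ∈ Finset.Icc 1 k,
        (((if n.Coprime Q then rootSet (P.comp (C (q : ℤ) * X + C (b₁ : ℤ))) n else ∅).card : ℕ)
          : ℝ) ≤ Cρ * k := by
  -- the primitive part
  have hP0 : P ≠ 0 := by rintro rfl; simp at hdeg
  set P₀ := P.primPart with hP₀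
  have hPeq : P = C P.content * P₀ := P.eq_C_content_mul_primPart
  have hdeg₀ : 0 < P₀.natDegree := by rw [hP₀, natDegree_primPart]; exact hdeg
  have hirr₀ : Irreducible P₀ := by
    have hprim : P₀.IsPrimitive := P.isPrimitive_primPart
    rw [hprim.irreducible_iff_irreducible_map_fraction_map (K := ℚ)]
    have hc0 : (P.content : ℚ) ≠ 0 := by
      have : P.content ≠ 0 := by rwa [Ne, Polynomial.content_eq_zero_iff]
      exact_mod_cast this
    have hmapP : P.map (Int.castRingHom ℚ) = C (P.content : ℚ) * P₀.map (algebraMap ℤ ℚ) := by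
      conv_lhs => rw [hPeq]
      rw [Polynomial.map_mul, Polynomial.map_C, algebraMap_int_eq]
      rfl
    rw [hmapP] at hirr
    exact (irreducible_isUnit_mul (Polynomial.isUnit_C.mpr (IsUnit.mk0 _ hc0))).mp hirr
  obtain ⟨C₁, hC₁, hsum⟩ := exists_sum_rootCount_le hirr₀ hdeg₀
  refine ⟨max C₁ 1, lt_max_of_lt_left hC₁, fun q b₁ Q hqQ hcQ k => ?_⟩
  -- compare with `ρ_{P₀}`
  have hterm : ∀ n ∈ Finset.Icc 1 k,
      (((if n.Coprime Q then rootSet (P.comp (C (q : ℤ) * X + C (b₁ : ℤ))) n else ∅).card : ℕ)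
        : ℝ) ≤ (polyRootCountMod ![P₀] n : ℝ) := by
    intro n hn
    have hn1 : 0 < n := (Finset.mem_Icc.mp hn).1
    split_ifs with hcop
    · have hqn : q.Coprime n := Nat.coprime_of_dvd fun p hp hpq hpn =>
        (Nat.Prime.coprime_iff_not_dvd hp).mp (Nat.Coprime.coprime_dvd_left hpn hcop) (hqQ p hp hpq)
      have hng : n.Coprime P.content.natAbs := Nat.coprime_of_dvd fun p hp hpn hpg =>
        (Nat.Prime.coprime_iff_not_dvd hp).mp (Nat.Coprime.coprime_dvd_left hpn hcop)
          (hcQ p hp (Int.ofNat_dvd_left.mpr hpg))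
      rw [card_rootSet_comp_eq P hn1 hqn]
      conv_lhs => rw [hPeq]
      rw [rootSet_C_mul _ hng, card_rootSet]
    · simp
  refine (Finset.sum_le_sum hterm).trans ?_
  rcases Nat.lt_or_ge k 2 with hk | hk
  · interval_cases k
    · simp
    · rw [Finset.Icc_self, Finset.sum_singleton]
      have : polyRootCountMod ![P₀] 1 ≤ 1 := by
        unfold polyRootCountMod
        exact (Finset.card_filter_le _ _).trans (by simp)
      have : (polyRootCountMod ![P₀] 1 : ℝ) ≤ 1 := by exact_mod_cast this
      have h2 : (1 : ℝ) ≤ max C₁ 1 := le_max_right _ _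
      push_cast; linarith
  · have h := hsum k (by exact_mod_cast hk)
    rw [Nat.floor_natCast] at h
    exact h.trans (mul_le_mul_of_nonneg_right (le_max_left _ _) (Nat.cast_nonneg _))


/-- `weylC` only depends on `R n`. [folklore] -/
theorem weylC_congr {R R' : ℕ → Finset ℕ} {n : ℕ} (h : R n = R' n) (d : ℤ) :
    weylC R n d = weylC R' n d := by
  unfold weylC; rw [h]

/-- `countA` only depends on `R n`. [folklore] -/
theorem countA_congr {R R' : ℕ → Finset ℕ} {n : ℕ} (h : R n = R' n) (S Y : ℝ) :
    countA R S Y n = countA R' S Y n := by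
  unfold countA; rw [h]

/-- `C ≤ y^ν` for all large `y ∈ ℕ` (`ν > 0`). [folklore] -/
theorem eventually_nat_le_rpow' {ν : ℝ} (hν : 0 < ν) (C : ℝ) :
    ∀ᶠ y : ℕ in Filter.atTop, C ≤ (y : ℝ) ^ ν :=
  ((tendsto_rpow_atTop hν).comp tendsto_natCast_atTop_atTop).eventually_ge_atTop C

set_option maxHeartbeats 1600000 in
/-- **Type-I information for the congruence counts of `P` from level Weyl-sum bounds for the
polynomials `P(qX + b₁)`.**  Let `P ∈ ℤ[X]` be irreducible over `ℚ` of positive degree, and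
suppose that for every `q ≥ 1`, `b₁` and every modulus `Q ≠ 0` containing the primes of `q`,
of `cont P` and of `2 · lc P · disc P` there is `K` with
`|∑_{n ≤ x, L ∣ n, (n,Q)=1} ∑_{ν mod n, P(qν+b₁) ≡ 0 (n)} e(hν/n)| ≤ K (1 + |h|)^C L^C x^{1−δ₀}`
for all `x`, `L ≥ 1`, `h ≠ 0` (a power-saving, level-`L` form of Hooley's equidistribution of the
roots to the moduli prime to the bad primes).  Then for `0 < ε`, `ε(20 + 6C) ≤ δ₀`, the type-I
hypothesis of `PropertySTypeI.dyadic_lower_bound` holds with `θ = ε₀ = ε`: for all `q ≥ 1`, `b₀`,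
every such `Q`, there are `K', y₀` with
`|∑_{N₁<n≤N₂, ℓ∣n, (n,Q)=1} (#{y<t≤2y : t ≡ b₀ (q), n ∣ P(t)} − (y/q)ρ_P(n)/n)| ≤ K' y^{1−ε}`
for `y ≥ y₀`, `1 ≤ ℓ ≤ y^ε`, `N₁ ≤ N₂ ≤ y^{1+ε}`.  Proof: `t = qs + b₀ mod q` turns the count into
the number of `s ∈ ((y−b₁)/q, (2y−b₁)/q]` in the root classes of `G = P(qX + b₁)` modulo `n`
(`card_progression_eq`), `ρ_G = ρ_P` on `(n, q) = 1` (`card_rootSet_comp_eq`), and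
`abs_typeI_le` with `N₀ = y^{1−2ε}`, blocks of length `y^{1−7ε}`, `H = y^{5ε}` (differences of the
hypothesised prefix sums feed `abs_typeI_le` directly; `norm_sum_level_coprime_le` records the
Möbius passage from all moduli, if only that form of the Weyl bound is available).
[cite: Hooley1967, §§3–6 (the method, for `n² − D`)] -/
theorem typeI_of_weylLevelBound (P : ℤ[X]) (hirr : Irreducible (P.map (Int.castRingHom ℚ)))
    (hdeg : 0 < P.natDegree) {δ₀ Cw : ℝ} (hδ₁ : δ₀ ≤ 1) (hC : 0 ≤ Cw)
    (HWL : ∀ q b₁ Q : ℕ, 1 ≤ q → Q ≠ 0 → (∀ p : ℕ, p.Prime → p ∣ q → p ∣ Q) →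
      (∀ p : ℕ, p.Prime → (p : ℤ) ∣ P.content → p ∣ Q) →
      (∀ p : ℕ, p.Prime → (p : ℤ) ∣ 2 * P.leadingCoeff *
        (P.coeff 1 ^ 2 - 4 * P.coeff 2 * P.coeff 0) → p ∣ Q) →
      ∃ K : ℝ, ∀ x L : ℕ, 1 ≤ L → ∀ h : ℤ, h ≠ 0 →
      ‖∑ n ∈ (Finset.Icc 1 x).filter (fun n => L ∣ n ∧ n.Coprime Q),
          polyRootWeylSum (P.comp (C (q : ℤ) * X + C (b₁ : ℤ))) n h‖ ≤
        K * (1 + |(h : ℝ)|) ^ Cw * (L : ℝ) ^ Cw * (x : ℝ) ^ (1 - δ₀))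
    {ε : ℝ} (hε : 0 < ε) (hεδ : ε * (20 + 6 * Cw) ≤ δ₀) :
    ∀ q b₀ Q : ℕ, 1 ≤ q → Q ≠ 0 → (∀ p : ℕ, p.Prime → p ∣ q → p ∣ Q) →
      (∀ p : ℕ, p.Prime → (p : ℤ) ∣ P.content → p ∣ Q) →
      (∀ p : ℕ, p.Prime → (p : ℤ) ∣ 2 * P.leadingCoeff *
        (P.coeff 1 ^ 2 - 4 * P.coeff 2 * P.coeff 0) → p ∣ Q) →
      ∃ (K : ℝ) (y₀ : ℕ), ∀ y : ℕ, y₀ ≤ y → ∀ ℓ N₁ N₂ : ℕ, 1 ≤ ℓ → (ℓ : ℝ) ≤ (y : ℝ) ^ ε →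
        N₁ ≤ N₂ → (N₂ : ℝ) ≤ (y : ℝ) ^ (1 + ε) →
        |∑ n ∈ (Finset.Ioc N₁ N₂).filter (fun n => ℓ ∣ n ∧ n.Coprime Q),
            ((((Finset.Ioc y (2 * y)).filter (fun t : ℕ => t % q = b₀ % q ∧
                (n : ℤ) ∣ P.eval (t : ℤ))).card : ℝ) -
              (y : ℝ) / q * (polyRootCountMod ![P] n : ℝ) / n)| ≤ K * (y : ℝ) ^ (1 - ε) := by
  intro q b₀ Q hq hQ0 hqQ hcQ hbadQ
  classical
  obtain ⟨Cρ, hCρ, hρsum⟩ := exists_sum_card_roots_le P hirr hdeg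
  have hb₁q : b₀ % q < q := Nat.mod_lt _ hq
  obtain ⟨KW', hKW'⟩ := HWL q (b₀ % q) Q hq hQ0 hqQ hcQ hbadQ
  have hKW0 : 0 ≤ max KW' 0 := le_max_right _ _
  have hWL : ∀ x L : ℕ, 1 ≤ L → ∀ h : ℤ, h ≠ 0 →
      ‖∑ n ∈ (Finset.Icc 1 x).filter (fun n => L ∣ n ∧ n.Coprime Q),
        polyRootWeylSum (P.comp (C (q : ℤ) * X + C ((b₀ % q : ℕ) : ℤ))) n h‖ ≤
        max KW' 0 * (1 + |(h : ℝ)|) ^ Cw * (L : ℝ) ^ Cw * (x : ℝ) ^ (1 - δ₀) := by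
    intro x L hL h hh
    refine (hKW' x L hL h hh).trans ?_
    have : 0 ≤ (1 + |(h : ℝ)|) ^ Cw * (L : ℝ) ^ Cw * (x : ℝ) ^ (1 - δ₀) := by positivity
    calc KW' * (1 + |(h : ℝ)|) ^ Cw * (L : ℝ) ^ Cw * (x : ℝ) ^ (1 - δ₀)
        = KW' * ((1 + |(h : ℝ)|) ^ Cw * (L : ℝ) ^ Cw * (x : ℝ) ^ (1 - δ₀)) := by ring
      _ ≤ max KW' 0 * ((1 + |(h : ℝ)|) ^ Cw * (L : ℝ) ^ Cw * (x : ℝ) ^ (1 - δ₀)) :=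
          mul_le_mul_of_nonneg_right (le_max_left _ _) this
      _ = _ := by ring
  have hδ₀ : 0 < δ₀ := lt_of_lt_of_le (by positivity) hεδ
  have hε20 : 20 * ε ≤ δ₀ := by nlinarith
  have hε7 : 7 * ε < 1 := by linarith
  -- the constant
  set K₃ : ℝ := 1872 * (2 : ℝ) ^ Cw * max KW' 0 with hK₃
  have hK₃0 : 0 ≤ K₃ := by rw [hK₃]; positivity
  -- largeness
  have e1 : ∀ᶠ y : ℕ in Filter.atTop, q ≤ y := Filter.eventually_ge_atTop q
  have e2 : ∀ᶠ y : ℕ in Filter.atTop, (2 : ℝ) ≤ (y : ℝ) ^ (1 - 2 * ε) :=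
    eventually_nat_le_rpow' (by linarith) _
  have e3 : ∀ᶠ y : ℕ in Filter.atTop, (2 : ℝ) ≤ (y : ℝ) ^ (1 - 7 * ε) :=
    eventually_nat_le_rpow' (by linarith) _
  have e4 : ∀ᶠ y : ℕ in Filter.atTop, (16 : ℝ) ≤ (y : ℝ) ^ (5 * ε) :=
    eventually_nat_le_rpow' (by positivity) _
  obtain ⟨y₀, hy₀⟩ := Filter.eventually_atTop.mp (e1.and (e2.and (e3.and e4)))
  refine ⟨9 * Cρ + K₃, max y₀ 1, fun y hy ℓ N₁ N₂ hℓ hℓy hN12 hN₂ => ?_⟩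
  obtain ⟨hyq, hy2, hy3, hy4⟩ := hy₀ y (le_trans (le_max_left _ _) hy)
  have hy1n : 1 ≤ y := le_trans (le_max_right _ _) hy
  have hy1 : (1 : ℝ) ≤ y := by exact_mod_cast hy1n
  have hy0 : (0 : ℝ) < y := by linarith
  have hq0 : (0 : ℝ) < q := by exact_mod_cast hq
  have hq1 : (1 : ℝ) ≤ q := by exact_mod_cast hq
  have hb₁y : b₀ % q ≤ y := le_trans hb₁q.le hyq
  have hmul : ∀ u v : ℝ, (y : ℝ) ^ u * (y : ℝ) ^ v = (y : ℝ) ^ (u + v) := fun u v =>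
    (Real.rpow_add hy0 u v).symm
  have hrle : ∀ {u v : ℝ}, u ≤ v → (y : ℝ) ^ u ≤ (y : ℝ) ^ v := fun h =>
    Real.rpow_le_rpow_of_exponent_le hy1 h
  have hrpos : ∀ u : ℝ, 0 < (y : ℝ) ^ u := fun u => Real.rpow_pos_of_pos hy0 u
  -- ## the data of `abs_typeI_le`
  obtain ⟨N₀, hN₀def⟩ : ∃ N : ℕ, N = ⌊(y : ℝ) ^ (1 - 2 * ε)⌋₊ := ⟨_, rfl⟩
  obtain ⟨lb, hlbdef⟩ : ∃ N : ℕ, N = ⌊(y : ℝ) ^ (1 - 7 * ε)⌋₊ := ⟨_, rfl⟩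
  obtain ⟨H, hHdef⟩ : ∃ N : ℕ, N = ⌊(y : ℝ) ^ (5 * ε)⌋₊ := ⟨_, rfl⟩
  have hN₀lo : (y : ℝ) ^ (1 - 2 * ε) / 2 ≤ N₀ := by rw [hN₀def]; exact half_le_floor hy2
  have hN₀hi : (N₀ : ℝ) ≤ (y : ℝ) ^ (1 - 2 * ε) := by rw [hN₀def]; exact Nat.floor_le (by positivity)
  have hlblo : (y : ℝ) ^ (1 - 7 * ε) / 2 ≤ lb := by rw [hlbdef]; exact half_le_floor hy3
  have hlbhi : (lb : ℝ) ≤ (y : ℝ) ^ (1 - 7 * ε) := by rw [hlbdef]; exact Nat.floor_le (by positivity)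
  have hHhi : (H : ℝ) ≤ (y : ℝ) ^ (5 * ε) := by rw [hHdef]; exact Nat.floor_le (by positivity)
  have hH1lo : (y : ℝ) ^ (5 * ε) ≤ (H : ℝ) + 1 := by
    rw [hHdef]; exact (Nat.lt_floor_add_one _).le
  have hN₀1 : 1 ≤ N₀ := by
    have : (1 : ℝ) ≤ N₀ := by linarith
    exact_mod_cast this
  have hlb1 : 1 ≤ lb := by
    have : (1 : ℝ) ≤ lb := by linarith
    exact_mod_cast this
  have hN₀pos : (0 : ℝ) < N₀ := by exact_mod_cast hN₀1
  have hlbpos : (0 : ℝ) < lb := by exact_mod_cast hlb1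
  have hH16 : (16 : ℝ) ≤ (H : ℝ) + 1 := hy4.trans hH1lo
  -- `δ' = 1/√(H+1)`
  have hsq : 4 ≤ Real.sqrt ((H : ℝ) + 1) := by
    rw [show (4 : ℝ) = Real.sqrt 16 by rw [show (16 : ℝ) = 4 ^ 2 by norm_num, Real.sqrt_sq (by norm_num)]]
    exact Real.sqrt_le_sqrt hH16
  have hsqpos : 0 < Real.sqrt ((H : ℝ) + 1) := by linarith
  have hδ'0 : 0 < 1 / Real.sqrt ((H : ℝ) + 1) := by positivity
  have hδ'4 : 1 / Real.sqrt ((H : ℝ) + 1) ≤ 1 / 4 := one_div_le_one_div_of_le (by norm_num) hsq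
  have hHδ : 1 ≤ ((H : ℝ) + 1) * (1 / Real.sqrt ((H : ℝ) + 1)) := by
    rw [mul_one_div, le_div_iff₀ hsqpos, one_mul]
    have hs1 : (1 : ℝ) ≤ Real.sqrt ((H : ℝ) + 1) := by linarith
    have hss : Real.sqrt ((H : ℝ) + 1) * Real.sqrt ((H : ℝ) + 1) = (H : ℝ) + 1 :=
      Real.mul_self_sqrt (by positivity)
    calc Real.sqrt ((H : ℝ) + 1) = Real.sqrt ((H : ℝ) + 1) * 1 := (mul_one _).symm
      _ ≤ Real.sqrt ((H : ℝ) + 1) * Real.sqrt ((H : ℝ) + 1) :=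
          mul_le_mul_of_nonneg_left hs1 hsqpos.le
      _ = (H : ℝ) + 1 := hss
  -- `Y`, `S`, the roots, `Φ`
  have hY0 : 0 < (y : ℝ) / q := div_pos hy0 hq0
  obtain ⟨R, hR⟩ : ∃ R : ℕ → Finset ℕ, R = fun n => if n.Coprime Q then
    rootSet (P.comp (C (q : ℤ) * X + C ((b₀ % q : ℕ) : ℤ))) n else ∅ := ⟨_, rfl⟩
  have hRcop : ∀ n : ℕ, n.Coprime Q →
      R n = rootSet (P.comp (C (q : ℤ) * X + C ((b₀ % q : ℕ) : ℤ))) n := fun n hn => by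
    rw [hR]; dsimp only; rw [if_pos hn]
  obtain ⟨Φ, hΦdef⟩ : ∃ F : ℝ, F = 2 * max KW' 0 *
      (1 + (H : ℝ)) ^ Cw * (ℓ : ℝ) ^ Cw * (N₂ : ℝ) ^ (1 - δ₀) := ⟨_, rfl⟩
  have hΦ0 : 0 ≤ Φ := by rw [hΦdef]; positivity
  -- ## the abstract bound
  have habs := abs_typeI_le R (fun n => ℓ ∣ n ∧ n.Coprime Q) (S := (2 * (y : ℝ) - (b₀ % q : ℕ)) / q)
    hY0 hN12 hlb1 hN₀1 (H := H) hδ'0 hδ'4 hHδ hΦ0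
    (fun k => by rw [hR]; exact hρsum q (b₀ % q) Q hqQ hcQ k)
    (by
      intro d hd hdH k₁ k₂ hk₁ hk12 hk₂
      have hsum : ∑ n ∈ (Finset.Ioc k₁ k₂).filter (fun n => ℓ ∣ n ∧ n.Coprime Q), weylC R n d =
          ∑ n ∈ (Finset.Ioc k₁ k₂).filter (fun n => ℓ ∣ n ∧ n.Coprime Q),
            polyRootWeylSum (P.comp (C (q : ℤ) * X + C ((b₀ % q : ℕ) : ℤ))) n (-d) := by
        refine Finset.sum_congr rfl fun n hn => ?_
        rw [Finset.mem_filter] at hn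
        rw [weylC_congr (hRcop n hn.2.2), weylC_rootSet]
      rw [hsum, sum_Ioc_filter_eq_sub (fun n => ℓ ∣ n ∧ n.Coprime Q) hk12]
      have hpre : ∀ k : ℕ, k ≤ N₂ →
          ‖∑ n ∈ (Finset.Icc 1 k).filter (fun n => ℓ ∣ n ∧ n.Coprime Q),
            polyRootWeylSum (P.comp (C (q : ℤ) * X + C ((b₀ % q : ℕ) : ℤ))) n (-d)‖ ≤ Φ / 2 := by
        intro k hk
        refine (hWL k ℓ hℓ (-d) (neg_ne_zero.mpr hd)).trans ?_
        rw [hΦdef]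
        have h1 : (1 + |((-d : ℤ) : ℝ)|) ^ Cw ≤ (1 + (H : ℝ)) ^ Cw := by
          refine Real.rpow_le_rpow (by positivity) ?_ hC
          push_cast; rw [abs_neg]
          have : |(d : ℝ)| ≤ H := by rw [← Int.cast_abs]; exact_mod_cast hdH
          linarith
        have h2 : (k : ℝ) ^ (1 - δ₀) ≤ (N₂ : ℝ) ^ (1 - δ₀) :=
          Real.rpow_le_rpow (Nat.cast_nonneg _) (by exact_mod_cast hk) (by linarith)
        calc max KW' 0 * (1 + |((-d : ℤ) : ℝ)|) ^ Cw * (ℓ : ℝ) ^ Cw * (k : ℝ) ^ (1 - δ₀)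
            ≤ max KW' 0 * (1 + (H : ℝ)) ^ Cw * (ℓ : ℝ) ^ Cw * (k : ℝ) ^ (1 - δ₀) := by
              apply mul_le_mul_of_nonneg_right _ (by positivity)
              apply mul_le_mul_of_nonneg_right _ (by positivity)
              exact mul_le_mul_of_nonneg_left h1 hKW0
          _ ≤ max KW' 0 * (1 + (H : ℝ)) ^ Cw * (ℓ : ℝ) ^ Cw * (N₂ : ℝ) ^ (1 - δ₀) := by
              apply mul_le_mul_of_nonneg_left h2; positivity
          _ = _ := by ring
      calc _ ≤ Φ / 2 + Φ / 2 := (norm_sub_le _ _).trans (add_le_add (hpre k₂ hk₂) (hpre k₁ (hk12.trans hk₂)))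
        _ = Φ := by ring)
  -- ## the left-hand side is the sum of the discrepancies
  have hlhs : ∑ n ∈ (Finset.Ioc N₁ N₂).filter (fun n => ℓ ∣ n ∧ n.Coprime Q),
      ((((Finset.Ioc y (2 * y)).filter (fun t : ℕ => t % q = b₀ % q ∧
          (n : ℤ) ∣ P.eval (t : ℤ))).card : ℝ) -
        (y : ℝ) / q * (polyRootCountMod ![P] n : ℝ) / n) =
      ∑ n ∈ (Finset.Ioc N₁ N₂).filter (fun n => ℓ ∣ n ∧ n.Coprime Q),
        disc R ((2 * (y : ℝ) - (b₀ % q : ℕ)) / q) ((y : ℝ) / q) n := by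
    refine Finset.sum_congr rfl fun n hn => ?_
    rw [Finset.mem_filter, Finset.mem_Ioc] at hn
    have hn1 : 0 < n := by omega
    have hcop := hn.2.2
    have hqn : q.Coprime n := Nat.coprime_of_dvd fun p hp hpq hpn =>
      (Nat.Prime.coprime_iff_not_dvd hp).mp (Nat.Coprime.coprime_dvd_left hpn hcop) (hqQ p hp hpq)
    unfold disc
    rw [countA_congr (hRcop n hcop), hRcop n hcop]
    have hcount := card_progression_eq P hq hb₁q hb₁y hn1
    have hcount' : ((((Finset.Ioc y (2 * y)).filter (fun t : ℕ => t % q = b₀ % q ∧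
        (n : ℤ) ∣ P.eval (t : ℤ))).card : ℕ) : ℝ) =
        ((countA (rootSet (P.comp (C (q : ℤ) * X + C ((b₀ % q : ℕ) : ℤ))))
          ((2 * (y : ℝ) - (b₀ % q : ℕ)) / q) ((y : ℝ) / q) n : ℤ) : ℝ) := by
      unfold countA
      exact_mod_cast hcount
    rw [hcount', card_rootSet_comp_eq P hn1 hqn, card_rootSet]
    ring
  rw [hlhs]
  refine habs.trans ?_
  -- ## numerics: every term is `≪ y^{1−ε}`
  have hss : Real.sqrt ((H : ℝ) + 1) * Real.sqrt ((H : ℝ) + 1) = (H : ℝ) + 1 :=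
    Real.mul_self_sqrt (by positivity)
  have hYle : (y : ℝ) / q ≤ y := div_le_self hy0.le hq1
  have hSabs : |(2 * (y : ℝ) - (b₀ % q : ℕ)) / q| ≤ 2 * y := by
    have hb0 : (0 : ℝ) ≤ (b₀ % q : ℕ) := Nat.cast_nonneg _
    have hby : ((b₀ % q : ℕ) : ℝ) ≤ y := by exact_mod_cast hb₁y
    rw [abs_of_nonneg (div_nonneg (by linarith) hq0.le)]
    calc (2 * (y : ℝ) - (b₀ % q : ℕ)) / q ≤ (2 * (y : ℝ) - (b₀ % q : ℕ)) / 1 :=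
          div_le_div_of_nonneg_left (by linarith) one_pos hq1
      _ ≤ 2 * y := by rw [div_one]; linarith
  -- powers of `y`
  have ha2 : ((y : ℝ) ^ (1 - 2 * ε)) ^ 2 = (y : ℝ) ^ (2 - 4 * ε) := by
    rw [sq, hmul]; congr 1; ring
  have hN₀sq : (y : ℝ) ^ (2 - 4 * ε) / 4 ≤ (N₀ : ℝ) ^ 2 := by
    have h := pow_le_pow_left₀ (by positivity) hN₀lo 2
    rw [div_pow, ha2] at h
    norm_num at h
    linarith
  have hN₀sq0 : (0 : ℝ) < (N₀ : ℝ) ^ 2 := by positivity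
  have hyb : (y : ℝ) * (y : ℝ) ^ (1 - 7 * ε) = (y : ℝ) ^ (2 - 7 * ε) := by
    rw [show (2 : ℝ) - 7 * ε = 1 + (1 - 7 * ε) by ring, Real.rpow_add hy0, Real.rpow_one]
  have hratio : (y : ℝ) * (y : ℝ) ^ (1 - 7 * ε) / ((y : ℝ) ^ (2 - 4 * ε) / 4) =
      4 * (y : ℝ) ^ (-(3 * ε)) := by
    have hd : (y : ℝ) ^ (2 - 7 * ε) / (y : ℝ) ^ (2 - 4 * ε) = (y : ℝ) ^ (-(3 * ε)) := by
      rw [← Real.rpow_sub hy0]; congr 1; ring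
    rw [hyb, ← hd]
    field_simp
  -- (T1)
  have hT1 : Cρ * (N₀ : ℝ) ≤ Cρ * (y : ℝ) ^ (1 - ε) :=
    mul_le_mul_of_nonneg_left (hN₀hi.trans (hrle (by linarith))) hCρ.le
  -- (T2)
  have hcoef1 : (y : ℝ) / q * lb / (N₀ : ℝ) ^ 2 ≤ 4 * (y : ℝ) ^ (-(3 * ε)) := by
    rw [← hratio]
    have hnum : (y : ℝ) / q * lb ≤ (y : ℝ) * (y : ℝ) ^ (1 - 7 * ε) :=
      mul_le_mul hYle hlbhi hlbpos.le hy0.le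
    exact div_le_div₀ (by positivity) hnum (by positivity) hN₀sq
  have hsqc : (y : ℝ) ^ (5 * ε / 2) ≤ Real.sqrt ((H : ℝ) + 1) := by
    have : Real.sqrt ((y : ℝ) ^ (5 * ε)) = (y : ℝ) ^ (5 * ε / 2) := by
      rw [Real.sqrt_eq_rpow, ← Real.rpow_mul hy0.le]; congr 1; ring
    rw [← this]; exact Real.sqrt_le_sqrt hH1lo
  have hfej : 2 * (1 / Real.sqrt ((H : ℝ) + 1)) + 2 / (((H : ℝ) + 1) * (1 / Real.sqrt ((H : ℝ) + 1))) ≤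
      4 * (y : ℝ) ^ (-(5 * ε / 2)) := by
    have h1 : ((H : ℝ) + 1) * (1 / Real.sqrt ((H : ℝ) + 1)) = Real.sqrt ((H : ℝ) + 1) := by
      rw [mul_one_div, div_eq_iff hsqpos.ne', hss]
    rw [h1, Real.rpow_neg hy0.le]
    have h2 : 1 / Real.sqrt ((H : ℝ) + 1) ≤ 1 / (y : ℝ) ^ (5 * ε / 2) :=
      one_div_le_one_div_of_le (hrpos _) hsqc
    have h3 : 2 / Real.sqrt ((H : ℝ) + 1) = 2 * (1 / Real.sqrt ((H : ℝ) + 1)) := by ring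
    rw [h3, ← one_div]
    linarith
  have hcoef : (y : ℝ) / q * lb / (N₀ : ℝ) ^ 2 + 2 * (1 / Real.sqrt ((H : ℝ) + 1)) +
      2 / (((H : ℝ) + 1) * (1 / Real.sqrt ((H : ℝ) + 1))) ≤ 8 * (y : ℝ) ^ (-(5 * ε / 2)) := by
    have : (y : ℝ) ^ (-(3 * ε)) ≤ (y : ℝ) ^ (-(5 * ε / 2)) := hrle (by linarith)
    linarith
  have hT2 : ((y : ℝ) / q * lb / (N₀ : ℝ) ^ 2 + 2 * (1 / Real.sqrt ((H : ℝ) + 1)) +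
      2 / (((H : ℝ) + 1) * (1 / Real.sqrt ((H : ℝ) + 1)))) * (Cρ * N₂) ≤
      8 * Cρ * (y : ℝ) ^ (1 - ε) := by
    have hN₂' : Cρ * (N₂ : ℝ) ≤ Cρ * (y : ℝ) ^ (1 + ε) := mul_le_mul_of_nonneg_left hN₂ hCρ.le
    calc _ ≤ 8 * (y : ℝ) ^ (-(5 * ε / 2)) * (Cρ * (y : ℝ) ^ (1 + ε)) :=
          mul_le_mul hcoef hN₂' (by positivity) (by positivity)
      _ = 8 * Cρ * ((y : ℝ) ^ (-(5 * ε / 2)) * (y : ℝ) ^ (1 + ε)) := by ring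
      _ ≤ 8 * Cρ * (y : ℝ) ^ (1 - ε) := by
          apply mul_le_mul_of_nonneg_left _ (by positivity)
          rw [hmul]; exact hrle (by linarith)
  -- (T3)
  have hX1 : (N₂ : ℝ) / lb + 1 ≤ 3 * (y : ℝ) ^ (8 * ε) := by
    have h1 : (N₂ : ℝ) / lb ≤ (y : ℝ) ^ (1 + ε) / ((y : ℝ) ^ (1 - 7 * ε) / 2) :=
      div_le_div₀ (by positivity) hN₂ (by positivity) hlblo
    have h2 : (y : ℝ) ^ (1 + ε) / ((y : ℝ) ^ (1 - 7 * ε) / 2) = 2 * (y : ℝ) ^ (8 * ε) := by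
      have hd : (y : ℝ) ^ (1 + ε) / (y : ℝ) ^ (1 - 7 * ε) = (y : ℝ) ^ (8 * ε) := by
        rw [← Real.rpow_sub hy0]; congr 1; ring
      rw [← hd]
      field_simp
    have h3 : (1 : ℝ) ≤ (y : ℝ) ^ (8 * ε) := Real.one_le_rpow hy1 (by positivity)
    linarith
  have hX2 : (y : ℝ) / q / N₀ + 1 ≤ 3 * (y : ℝ) ^ (2 * ε) := by
    have h1 : (y : ℝ) / q / N₀ ≤ (y : ℝ) / ((y : ℝ) ^ (1 - 2 * ε) / 2) :=
      div_le_div₀ hy0.le hYle (by positivity) hN₀lo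
    have h2 : (y : ℝ) / ((y : ℝ) ^ (1 - 2 * ε) / 2) = 2 * (y : ℝ) ^ (2 * ε) := by
      have hd : (y : ℝ) / (y : ℝ) ^ (1 - 2 * ε) = (y : ℝ) ^ (2 * ε) := by
        rw [div_eq_iff (hrpos _).ne', hmul, show 2 * ε + (1 - 2 * ε) = (1 : ℝ) by ring,
          Real.rpow_one]
      rw [← hd]
      field_simp
    have h3 : (1 : ℝ) ≤ (y : ℝ) ^ (2 * ε) := Real.one_le_rpow hy1 (by positivity)
    linarith
  have hX3 : 2 * (H : ℝ) ≤ 2 * (y : ℝ) ^ (5 * ε) := by linarith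
  have hX4 : 1 + 2 * Real.pi * |(2 * (y : ℝ) - (b₀ % q : ℕ)) / q| * lb / (N₀ : ℝ) ^ 2 ≤ 52 := by
    have h1 : 2 * Real.pi * |(2 * (y : ℝ) - (b₀ % q : ℕ)) / q| * lb / (N₀ : ℝ) ^ 2 ≤
        2 * Real.pi * (2 * y) * (y : ℝ) ^ (1 - 7 * ε) / ((y : ℝ) ^ (2 - 4 * ε) / 4) := by
      refine div_le_div₀ (by positivity) ?_ (by positivity) hN₀sq
      exact mul_le_mul (mul_le_mul_of_nonneg_left hSabs (by positivity)) hlbhi hlbpos.le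
        (by positivity)
    have h2 : 2 * Real.pi * (2 * y) * (y : ℝ) ^ (1 - 7 * ε) / ((y : ℝ) ^ (2 - 4 * ε) / 4) =
        4 * Real.pi * (4 * (y : ℝ) ^ (-(3 * ε))) := by
      rw [← hratio]; ring
    have h3 : (y : ℝ) ^ (-(3 * ε)) ≤ 1 := Real.rpow_le_one_of_one_le_of_nonpos hy1 (by linarith)
    have h4 := Real.pi_lt_d2
    nlinarith [Real.pi_pos]
  have hcy : (1 : ℝ) ≤ (y : ℝ) ^ (5 * ε) := Real.one_le_rpow hy1 (by positivity)
  have hX5 : Φ ≤ 2 * max KW' 0 * (2 : ℝ) ^ Cw *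
      ((y : ℝ) ^ (5 * ε * Cw) * (y : ℝ) ^ (ε * Cw) * (y : ℝ) ^ ((1 + ε) * (1 - δ₀))) := by
    rw [hΦdef]
    have h1 : (1 + (H : ℝ)) ^ Cw ≤ (2 : ℝ) ^ Cw * (y : ℝ) ^ (5 * ε * Cw) := by
      rw [Real.rpow_mul hy0.le, ← Real.mul_rpow (by norm_num) (by positivity)]
      exact Real.rpow_le_rpow (by positivity) (by linarith) hC
    have h2 : (ℓ : ℝ) ^ Cw ≤ (y : ℝ) ^ (ε * Cw) := by
      rw [Real.rpow_mul hy0.le]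
      exact Real.rpow_le_rpow (by positivity) hℓy hC
    have h3 : (N₂ : ℝ) ^ (1 - δ₀) ≤ (y : ℝ) ^ ((1 + ε) * (1 - δ₀)) := by
      rw [Real.rpow_mul hy0.le]
      exact Real.rpow_le_rpow (Nat.cast_nonneg _) hN₂ (by linarith)
    have h0 : 0 ≤ 2 * max KW' 0 := by positivity
    calc 2 * max KW' 0 * (1 + (H : ℝ)) ^ Cw * (ℓ : ℝ) ^ Cw * (N₂ : ℝ) ^ (1 - δ₀)
        = 2 * max KW' 0 * ((1 + (H : ℝ)) ^ Cw * (ℓ : ℝ) ^ Cw * (N₂ : ℝ) ^ (1 - δ₀)) := by ring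
      _ ≤ 2 * max KW' 0 * (((2 : ℝ) ^ Cw * (y : ℝ) ^ (5 * ε * Cw)) *
          (y : ℝ) ^ (ε * Cw) * (y : ℝ) ^ ((1 + ε) * (1 - δ₀))) := by
          apply mul_le_mul_of_nonneg_left _ h0
          exact mul_le_mul (mul_le_mul h1 h2 (by positivity) (by positivity)) h3 (by positivity)
            (by positivity)
      _ = _ := by ring
  have hE : (y : ℝ) ^ (8 * ε) * (y : ℝ) ^ (2 * ε) * (y : ℝ) ^ (5 * ε) *
      ((y : ℝ) ^ (5 * ε * Cw) * (y : ℝ) ^ (ε * Cw) * (y : ℝ) ^ ((1 + ε) * (1 - δ₀))) ≤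
      (y : ℝ) ^ (1 - ε) := by
    rw [hmul, hmul, hmul, hmul, hmul]
    refine hrle ?_
    have h1 : 0 ≤ ε * δ₀ := by positivity
    nlinarith
  have hT3 : ((N₂ : ℝ) / lb + 1) * ((y : ℝ) / q / N₀ + 1) *
      (2 * (H : ℝ) * (1 + 2 * Real.pi * |(2 * (y : ℝ) - (b₀ % q : ℕ)) / q| * lb / (N₀ : ℝ) ^ 2) * Φ) ≤
      K₃ * (y : ℝ) ^ (1 - ε) := by
    have hA : ((N₂ : ℝ) / lb + 1) * ((y : ℝ) / q / N₀ + 1) ≤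
        (3 * (y : ℝ) ^ (8 * ε)) * (3 * (y : ℝ) ^ (2 * ε)) :=
      mul_le_mul hX1 hX2 (by positivity) (by positivity)
    have hB : 2 * (H : ℝ) * (1 + 2 * Real.pi * |(2 * (y : ℝ) - (b₀ % q : ℕ)) / q| * lb / (N₀ : ℝ) ^ 2) * Φ ≤
        (2 * (y : ℝ) ^ (5 * ε)) * 52 * (2 * max KW' 0 * (2 : ℝ) ^ Cw *
          ((y : ℝ) ^ (5 * ε * Cw) * (y : ℝ) ^ (ε * Cw) * (y : ℝ) ^ ((1 + ε) * (1 - δ₀)))) :=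
      mul_le_mul (mul_le_mul hX3 hX4 (by positivity) (by positivity)) hX5 hΦ0 (by positivity)
    calc _ ≤ (3 * (y : ℝ) ^ (8 * ε)) * (3 * (y : ℝ) ^ (2 * ε)) *
          ((2 * (y : ℝ) ^ (5 * ε)) * 52 * (2 * max KW' 0 * (2 : ℝ) ^ Cw *
            ((y : ℝ) ^ (5 * ε * Cw) * (y : ℝ) ^ (ε * Cw) * (y : ℝ) ^ ((1 + ε) * (1 - δ₀))))) :=
          mul_le_mul hA hB (by positivity) (by positivity)
      _ = K₃ * ((y : ℝ) ^ (8 * ε) * (y : ℝ) ^ (2 * ε) * (y : ℝ) ^ (5 * ε) *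
          ((y : ℝ) ^ (5 * ε * Cw) * (y : ℝ) ^ (ε * Cw) * (y : ℝ) ^ ((1 + ε) * (1 - δ₀)))) := by
          rw [hK₃]; ring
      _ ≤ K₃ * (y : ℝ) ^ (1 - ε) := mul_le_mul_of_nonneg_left hE hK₃0
  have hfinal := add_le_add (add_le_add hT1 hT2) hT3
  refine hfinal.trans (le_of_eq ?_)
  ring

end Final

end TypeIFromWeyl

end Literature.NumberTheory.Sieve

end
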